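import Summits.Ventures.HSemireg.Pad4TowerPermCovarianceStatic
import Summits.HodgeConjecture.HodgeConjecture.Cruxes.BlochSeedDiscOne.SeedCheckerPorteous

/-!
# Split degeneracy-carrier designs `DC1728` ∕ `DC964` ∕ `DCi21224` — KERNEL CERTIFICATE of the CLASS HALF (C0 at virtual rank 3) of three fully (A1)-clean
# Family-1 Thom–Porteous carriers (hsemireg-alphabet-isogeny-1 g16; MINT block B3; this seat's designs, NOT designs of record)

HONEST FRAMING. Crux of record `…Theses.EightfoldBlochSeeds.BlochSeedDiscOne` (stmt-HodgeConjecture-18881; skeleton `Lines/birth.lean`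
814a6a70c14e831a UNTOUCHED; sub-rung `stub_pad4_carrier` = the (A1) half of `HasLciCarrierAt`). A FAMILY-1 SPLIT DEGENERACY CARRIER (g15
`SPLIT-DEGENERACY-CARRIERS-isogeny1-g15.md`, CARRIER-960; the degeneracy door of `SeedCheckerPorteous.lean` §8 with `𝓟 = 𝒪^{f−3}`) is the two-term datum
`φ : 𝒪^{⊕(f−3)} → F`, `F = ⊕` of `f` isotropic ample LINE-BUNDLE LETTERS `α(u+v) + βe + β̄ē` (`α ∈ ℤ_{>0}`, `β ∈ ℤ[i]`, `α² > |β|²`) boxed over the four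
factors of the pad-4 anchor; its corank-1 locus `Z = D(φ)` has expected codimension `4` and Thom–Porteous class `[Z] = c₄(F − 𝒪^{f−3}) = c₄(F)`, whose
`W = ⟨eeee, ēēēē⟩`-coordinate is `−6μ`, `μ = wch(design)(eeee)`. The json input the door reads on such a datum is C0 of the design `(N, P) =
(letters of F with multiplicities, apex (0,0,0)⁴ × (f−3))`: (A1) IN ALL DEGREES (`Design.Clean` = `Pad4TowerClassScreen.ClassScreen` of the weighted
class tensor — the door's `hD' : D'.Clean`), `μ ≠ 0`, rank `3`, positivity. g15's carrier D960 is (A1)-clean in degrees `≤ 4` ONLY (this seat's engine: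
its e-free words `puuu`∕`ppu1` carry `31 680 ≠ 33 728` in degree 5 and `ppuu`∕`ppp1` carry `62 400 ≠ 74 688` in degree 6; likewise D1384), so it does
NOT meet `Design.Clean`. THIS MODULE decides, for three designs found by this seat's exact LP over `H′ × S₄`-types of isotropic letters with the six
balance rows of ALL degrees (`family1_full_lp.py` ∕ `family1_small.py`) and re-checked word by word over all `1296` words by an independent engine
(`d960cert.py`): **DC1728** (§1: `f = 1728`, 128 cells in 7 `G₁`-orbits, `μ = -256`, rank 3), **DC964** (§2: `f = 964`, 218 cells in 8 `G₁`-orbits, `μ = 128`, rank 3), **DCi21224** (§3: `f = 21224`, 178 cells in 9 `G₁`-orbits, `μ = -448 +1536·i`, rank 3)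
— that the support IS `G₁ = S₄ × ⟨Δ⟩`-closed, the multiplicities ARE `G₁`-invariant and positive, every `N`-letter IS isotropic-ample and `P` IS the apex,
the weighted class tensor PASSES THE CLASS SCREEN (A1) in all degrees, the rank is `3`, and `μ` has the stated non-zero value (ℤ[i]-arithmetic in the
kernel: two one-pass integer evaluations over all cells for the 22 + 1 representative words; the other words follow from `u`~`v` merging, the `S₄`
symmetry and the Δ-window — theorems of the tree — and a decided word-orbit cover); §k.6 certifies the rank-4 json key `(N, apex × (f−4))` (the shape
`Design.ClassData` keys on; its `padApexUp 0 1` companion is the rank-3 design), and §k.7 says so IN THE DOOR'S OWN VOCABULARY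
(`SeedChecker.Design`, second import): `D₄.ClassData`, `D₃.Clean`, `D₃.ClassDataR 3`, `D₃.mu = D₄.mu` and, literally, `D₄.padApexUp 0 1 = D₃` — the json
hypotheses `hC0` ∕ `hD'` ∕ `hmu` of `SeedCheckerPorteous.Design.seedCheck_of_twoTermDegeneracy` with `D = D₄`, `D' = D₃`, and nothing else of that door. TRANSCRIPTION: orbit representatives `(α, Re β, Im β)` per factor
(`mcellOf …`), one per `G₁`-orbit (the orbit's minimal `key`) with the orbit's multiplicity; all other cells GENERATED IN THE KERNEL from the packed
transversal codes and certified against the representatives' orbits by the closure check (generator `gen_carrier_cert.py`, this seat, after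
hsemireg-check-kernel-1's `gen_cert.py`). (A1) + `μ ≠ 0` is necessary, not sufficient, for a seed; the `P`-side `𝒪^{f−3}` is the repeated trivial letter
of hsemireg-c4-1 g2's DL hazard (advisory `Design.PorteousScreenDL`), neither encoded nor evaded here.
NOTHING HERE IS A BUNDLE MAP, A DEGENERACY SCHEME, A SEED OR A RUNG; NOTHING HERE SAYS THAT HC ∕ HC_CM ∕ HC_AV ∕ №4 ∕ 26512 ∕ 18881 ∕ H2 HOLDS OR FAILS.
What is decided is the CLASS half C0 only (json side); the object side of the degeneracy door — `φ : 𝒪^{f−3} → F` with `D(φ)` of codimension 4 (C5),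
integral (C6), Bloch-semiregular (C7) — and the law `PorteousFourLocalisation` are untouched, exactly as flagged in `SeedCheckerPorteous.lean` §8.
`decide +kernel` only: NO `native_decide`, no `sorry`, no `axiom`, no `instance`, no notation, no Literature fact; the only `def … : Prop`s are the
bookkeeping abbreviations of §0 (head predicates, `G1C`, `PInv`) and the two certificate bundles `LevelCert` ∕ `DesignCert`.
IMPORTS: `Pad4TowerPermCovarianceStatic` (for §0) and `Cruxes/BlochSeedDiscOne/SeedCheckerPorteous` (for §k.7 only). §0 below is a VERBATIM copy of the generic machinery `Cruxes/BlochSeedDiscOne/DesignKernel.lean` §1–§9 (hsemireg-check-kernel-1; same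
declarations, this module's namespace — the construction of `DesignCertS84A0.lean`), so that the certificate does not depend on another crux
workfile's build state.
-/

set_option linter.dupNamespace false
set_option linter.unnecessarySeqFocus false
set_option maxRecDepth 8192
set_option maxHeartbeats 4000000
set_option synthInstance.maxSize 8192
set_option synthInstance.maxHeartbeats 2000000

namespace Summit.HodgeConjecture.HodgeConjecture.Cruxes.BlochSeedDiscOne.SplitCarrierClassCert

open Summit.Ventures.HSemireg Summit.Ventures.HSemireg.Pad4Tower

/-! # §0 Generic machinery (verbatim copy of `DesignKernel.lean` §1–§9, tree sha16 de793659a81ebd57) -/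


/-! ### §0.1 Raw `ℤ[i]` arithmetic and the raw class-tensor evaluator -/

/-- product of Gaussian integers written as integer pairs `(re, im)`. -/
def gmul (a b : ℤ × ℤ) : ℤ × ℤ := (a.1 * b.1 - a.2 * b.2, a.1 * b.2 + a.2 * b.1)

/-- the pair as a Gaussian integer. -/
def toG (p : ℤ × ℤ) : GaussianInt := ⟨p.1, p.2⟩

/-- `gmul` is multiplication in `ℤ[i]`. -/
theorem toG_gmul (a b : ℤ × ℤ) : toG (gmul a b) = toG a * toG b := by
  ext
  · simp [toG, gmul, Zsqrtd.re_mul]; ring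
  · simp [toG, gmul, Zsqrtd.im_mul]

/-- force an integer to constructor form before continuing (keeps kernel evaluation of long folds strict). -/
def forceInt {α : Type} (z : ℤ) (k : ℤ → α) : α :=
  match z with
  | Int.ofNat n => k (Int.ofNat n)
  | Int.negSucc n => k (Int.negSucc n)

/-- forcing does not change the value. -/
theorem forceInt_eq {α : Type} (z : ℤ) (k : ℤ → α) : forceInt z k = k z := by
  cases z <;> rfl

/-- the letter vector `(1, α, α, β, β̄, α² − |β|²)` of a factor point as integer pairs (raw form of `bphi`). -/
def letv (x : BPoint) (l : Fin 6) : ℤ × ℤ :=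
  match l.val with
  | 0 => (1, 0)
  | 1 => (x.1, 0)
  | 2 => (x.1, 0)
  | 3 => (x.2.1, x.2.2)
  | 4 => (x.2.1, -x.2.2)
  | _ => (x.1 * x.1 - x.2.1 * x.2.1 - x.2.2 * x.2.2, 0)

/-- `letv` is `bphi`, letter by letter. -/
theorem toG_letv (x : BPoint) (l : Fin 6) : toG (letv x l) = bphi x l := by
  fin_cases l <;>
    (ext <;> simp [toG, letv, bphi, phiVec, pow_two, Zsqrtd.re_mul, Zsqrtd.im_mul, Zsqrtd.re_intCast, Zsqrtd.im_intCast])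

/-- raw class tensor of one cell at a word (raw form of `MCell.ch`). -/
def chRaw (Z : MCell) (w : CWord) : ℤ × ℤ :=
  gmul (gmul (gmul (letv (Z 0) (w 0)) (letv (Z 1) (w 1))) (letv (Z 2) (w 2))) (letv (Z 3) (w 3))

/-- `chRaw` is `MCell.ch`. -/
theorem toG_chRaw (Z : MCell) (w : CWord) : toG (chRaw Z w) = Z.ch w := by
  simp only [chRaw, toG_gmul, toG_letv, MCell.ch, chTensor]

/-- raw weighted sum `Σ m · ch(Z)(w)` over a multiplicity list, accumulator form, integers forced at every step. -/
def sumRaw (w : CWord) : List (MCell × ℤ) → ℤ → ℤ → ℤ × ℤ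
  | [], s, t => (s, t)
  | (Z, m) :: L, s, t =>
    match chRaw Z w with
    | (a, b) => forceInt (s + m * a) fun s' => forceInt (t + m * b) fun t' => sumRaw w L s' t'

/-- the list sum the accumulator computes. -/
def listSum (w : CWord) (L : List (MCell × ℤ)) : GaussianInt := (L.map fun p => (p.2 : GaussianInt) * p.1.ch w).sum

/-- the accumulator computes `(s, t) + Σ m · ch(Z)(w)`. -/
theorem toG_sumRaw (w : CWord) (L : List (MCell × ℤ)) (s t : ℤ) :
    toG (sumRaw w L s t) = toG (s, t) + listSum w L := by
  induction L generalizing s t with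
  | nil => simp [sumRaw, listSum, toG]
  | cons p L ih =>
    obtain ⟨Z, m⟩ := p
    have hc : toG (chRaw Z w) = Z.ch w := toG_chRaw Z w
    simp only [sumRaw, forceInt_eq]
    rw [ih]
    simp only [listSum, List.map_cons, List.sum_cons]
    rw [← hc]
    ext
    · simp [toG]; ring
    · simp [toG]; ring

/-- the raw class tensor of a design `(N-list, P-list)` at a word: `Σ_N m ch − Σ_P m ch`. -/
def rawT (LN LP : List (MCell × ℤ)) (w : CWord) : ℤ × ℤ :=
  match sumRaw w LN 0 0, sumRaw w LP 0 0 with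
  | (a, b), (c, d) => (a - c, b - d)

/-- the raw design tensor is `Σ_N − Σ_P` of the list sums. -/
theorem toG_rawT (LN LP : List (MCell × ℤ)) (w : CWord) : toG (rawT LN LP w) = listSum w LN - listSum w LP := by
  have hN := toG_sumRaw w LN 0 0
  have hP := toG_sumRaw w LP 0 0
  have h0 : toG ((0 : ℤ), (0 : ℤ)) = 0 := by ext <;> simp [toG]
  rw [h0, zero_add] at hN hP
  rw [← hN, ← hP]
  ext <;> simp [toG, rawT]

/-- the level of a multiplicity list as a `Finset` WITHOUT re-deduplication (the cell list is `Nodup`). -/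
def levelOf (L : List (MCell × ℤ)) (hL : (L.map Prod.fst).Nodup) : Finset MCell := ⟨↑(L.map Prod.fst), by simpa using hL⟩

/-- membership in a level is membership in the cell list. -/
theorem mem_levelOf {L : List (MCell × ℤ)} {hL : (L.map Prod.fst).Nodup} {Z : MCell} : Z ∈ levelOf L hL ↔ Z ∈ L.map Prod.fst := Iff.rfl

/-- the weighted sum over a level, for ANY multiplicity function agreeing with the list on its cells, is the list sum. -/
theorem sum_levelOf (L : List (MCell × ℤ)) (hL : (L.map Prod.fst).Nodup) (m : MCell → ℤ) (hm : ∀ p ∈ L, m p.1 = p.2) (w : CWord) :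
    (∑ Z ∈ levelOf L hL, m Z • Z.ch) w = listSum w L := by
  rw [Finset.sum_apply]
  have h1 : ∑ Z ∈ levelOf L hL, (m Z • Z.ch) w = ((L.map Prod.fst).map fun Z => (m Z • Z.ch) w).sum := by
    simp only [levelOf, Finset.sum_mk, Multiset.map_coe, Multiset.sum_coe]
  rw [h1, List.map_map, listSum]
  congr 1
  refine List.map_congr_left fun p hp => ?_
  simp only [Function.comp_apply, Pi.smul_apply, zsmul_eq_mul]
  rw [hm p hp]

/-- the configuration of a design `(N-list, P-list)`. -/
def cfgOf (LN LP : List (MCell × ℤ)) (hN : (LN.map Prod.fst).Nodup) (hP : (LP.map Prod.fst).Nodup) : MConfig :=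
  ⟨levelOf LN hN, levelOf LP hP⟩

/-- **BRIDGE**: the tree's weighted class tensor of the design IS the raw evaluator, at every word, for any multiplicity functions that agree
with the lists on their cells. -/
theorem wch_eq_raw (LN LP : List (MCell × ℤ)) (hN : (LN.map Prod.fst).Nodup) (hP : (LP.map Prod.fst).Nodup)
    (mN mP : MCell → ℤ) (hmN : ∀ p ∈ LN, mN p.1 = p.2) (hmP : ∀ p ∈ LP, mP p.1 = p.2) (w : CWord) :
    (cfgOf LN LP hN hP).wch mN mP w = toG (rawT LN LP w) := by
  rw [toG_rawT, MConfig.wch, Pi.sub_apply]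
  show (∑ Z ∈ levelOf LN hN, mN Z • Z.ch) w - (∑ P ∈ levelOf LP hP, mP P • P.ch) w = _
  rw [sum_levelOf LN hN mN hmN, sum_levelOf LP hP mP hmP]

/-- the class tensor at the unit word `1111` is the RANK `Σ m_N − Σ m_P` (every cell has `ch(Z)(1111) = 1`). -/
theorem wch_one_eq (C : MConfig) (mN mP : MCell → ℤ) :
    C.wch mN mP ![0, 0, 0, 0] = ((∑ Z ∈ C.lower, mN Z) - ∑ P ∈ C.upper, mP P : ℤ) := by
  have h1 : ∀ Z : MCell, Z.ch ![0, 0, 0, 0] = 1 := fun Z => by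
    simp [MCell.ch, chTensor, bphi, phiVec]
  simp only [MConfig.wch, Pi.sub_apply, Finset.sum_apply, Pi.smul_apply]
  simp only [h1, zsmul_eq_mul, mul_one]
  push_cast
  rfl

/-- total multiplicity of a list, accumulator form. -/
def msum : List (MCell × ℤ) → ℤ → ℤ
  | [], s => s
  | (_, m) :: L, s => forceInt (s + m) fun s' => msum L s'

/-- the accumulator computes the total multiplicity. -/
theorem msum_eq (L : List (MCell × ℤ)) (s : ℤ) : msum L s = s + (L.map Prod.snd).sum := by
  induction L generalizing s with
  | nil => simp [msum]
  | cons p L ih => obtain ⟨Z, m⟩ := p; simp [msum, forceInt_eq, ih, add_assoc]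

/-- the level sum of any multiplicity function agreeing with the list is the accumulator value. -/
theorem sum_level_m (L : List (MCell × ℤ)) (hL : (L.map Prod.fst).Nodup) (m : MCell → ℤ) (hm : ∀ p ∈ L, m p.1 = p.2) :
    ∑ Z ∈ levelOf L hL, m Z = msum L 0 := by
  have h1 : ∑ Z ∈ levelOf L hL, m Z = ((L.map Prod.fst).map m).sum := by
    simp only [levelOf, Finset.sum_mk, Multiset.map_coe, Multiset.sum_coe]
  rw [h1, List.map_map, msum_eq, zero_add]
  congr 1
  exact List.map_congr_left fun p hp => by simpa using hm p hp

/-! ### §0.2 Iterative Boolean list checkers -/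

/-- `allB l f`: every element passes the Boolean test (tail form: the kernel loops instead of recursing). -/
def allB {α : Type} : List α → (α → Bool) → Bool
  | [], _ => true
  | x :: l, f => match f x with | true => allB l f | false => false

/-- spec of `allB`. -/
theorem allB_iff {α : Type} (l : List α) (f : α → Bool) : allB l f = true ↔ ∀ x ∈ l, f x = true := by
  induction l with
  | nil => simp [allB]
  | cons x l ih =>
    simp only [allB, List.mem_cons, forall_eq_or_imp]
    cases hx : f x <;> simp [ih]

/-- `allB` with a decidable predicate. -/
theorem forall_of_allB {α : Type} {l : List α} {p : α → Prop} [DecidablePred p] (h : allB l (fun x => decide (p x)) = true) :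
    ∀ x ∈ l, p x := fun x hx => of_decide_eq_true ((allB_iff l _).1 h x hx)

/-- strictly increasing list of naturals, tail form. -/
def chainB : List ℕ → Bool
  | [] => true
  | [_] => true
  | a :: b :: l => match Nat.blt a b with | true => chainB (b :: l) | false => false

/-- spec of `chainB`. -/
theorem isChain_of_chainB : ∀ (l : List ℕ), chainB l = true → l.IsChain (· < ·)
  | [], _ => List.IsChain.nil
  | [a], _ => List.IsChain.singleton a
  | a :: b :: l, h => by
    simp only [chainB] at h
    cases hab : Nat.blt a b
    · rw [hab] at h; simp at h
    · rw [hab] at h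
      exact List.IsChain.cons_cons (by simpa using hab) (isChain_of_chainB (b :: l) h)

/-- a list whose image under a key `k : MCell → ℕ` is strictly increasing has no duplicate cells (no injectivity needed). -/
theorem nodup_of_keys (k : MCell → ℕ) {l : List MCell} (h : (l.map k).IsChain (· < ·)) : l.Nodup :=
  (List.pairwise_map.1 h.pairwise).imp fun hab e => by subst e; exact Nat.lt_irrefl _ hab

/-! ### §0.3 Designs as G₁-orbit data -/

/-- order key of a letter (as `Pad4TowerLineDesignCert12Closure.enc`): base-64 digits of the shifted coordinates. -/
def enc (x : BPoint) : ℕ := (x.1 + 16).toNat * 4096 + (x.2.1 + 16).toNat * 64 + (x.2.2 + 16).toNat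
/-- order key of a cell (lexicographic in the four letters). -/
def key (Z : MCell) : ℕ := ((enc (Z 0) * 262144 + enc (Z 1)) * 262144 + enc (Z 2)) * 262144 + enc (Z 3)

/-- an explicit permutation of `Fin 4` from its table and the inverse table. -/
def mkPerm (f g : Fin 4 → Fin 4) (h₁ : ∀ x, g (f x) = x) (h₂ : ∀ x, f (g x) = x) : Equiv.Perm (Fin 4) := ⟨f, g, h₁, h₂⟩

/-- the 24 elements of `S₄` in lexicographic order of their tables (index `s`; `(Z.perm σ) f = Z (σ f)`). -/
def permList : List (Equiv.Perm (Fin 4)) :=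
  [mkPerm ![0, 1, 2, 3] ![0, 1, 2, 3] (by decide) (by decide), mkPerm ![0, 1, 3, 2] ![0, 1, 3, 2] (by decide) (by decide),
   mkPerm ![0, 2, 1, 3] ![0, 2, 1, 3] (by decide) (by decide), mkPerm ![0, 2, 3, 1] ![0, 3, 1, 2] (by decide) (by decide),
   mkPerm ![0, 3, 1, 2] ![0, 2, 3, 1] (by decide) (by decide), mkPerm ![0, 3, 2, 1] ![0, 3, 2, 1] (by decide) (by decide),
   mkPerm ![1, 0, 2, 3] ![1, 0, 2, 3] (by decide) (by decide), mkPerm ![1, 0, 3, 2] ![1, 0, 3, 2] (by decide) (by decide),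
   mkPerm ![1, 2, 0, 3] ![2, 0, 1, 3] (by decide) (by decide), mkPerm ![1, 2, 3, 0] ![3, 0, 1, 2] (by decide) (by decide),
   mkPerm ![1, 3, 0, 2] ![2, 0, 3, 1] (by decide) (by decide), mkPerm ![1, 3, 2, 0] ![3, 0, 2, 1] (by decide) (by decide),
   mkPerm ![2, 0, 1, 3] ![1, 2, 0, 3] (by decide) (by decide), mkPerm ![2, 0, 3, 1] ![1, 3, 0, 2] (by decide) (by decide),
   mkPerm ![2, 1, 0, 3] ![2, 1, 0, 3] (by decide) (by decide), mkPerm ![2, 1, 3, 0] ![3, 1, 0, 2] (by decide) (by decide),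
   mkPerm ![2, 3, 0, 1] ![2, 3, 0, 1] (by decide) (by decide), mkPerm ![2, 3, 1, 0] ![3, 2, 0, 1] (by decide) (by decide),
   mkPerm ![3, 0, 1, 2] ![1, 2, 3, 0] (by decide) (by decide), mkPerm ![3, 0, 2, 1] ![1, 3, 2, 0] (by decide) (by decide),
   mkPerm ![3, 1, 0, 2] ![2, 1, 3, 0] (by decide) (by decide), mkPerm ![3, 1, 2, 0] ![3, 1, 2, 0] (by decide) (by decide),
   mkPerm ![3, 2, 0, 1] ![2, 3, 1, 0] (by decide) (by decide), mkPerm ![3, 2, 1, 0] ![3, 2, 1, 0] (by decide) (by decide)]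

/-- `Δ^j`. -/
def deltaIter : ℕ → MCell → MCell
  | 0, Z => Z
  | j + 1, Z => (deltaIter j Z).delta

/-- force a factor point to literal form. -/
def forcePt {α : Type} (x : BPoint) (k : BPoint → α) : α :=
  forceInt x.1 fun a => forceInt x.2.1 fun b => forceInt x.2.2 fun c => k (a, b, c)

theorem forcePt_eq {α : Type} (x : BPoint) (k : BPoint → α) : forcePt x k = k x := by
  obtain ⟨a, b, c⟩ := x; simp [forcePt, forceInt_eq]

/-- force a cell to the literal form `mcellOf x₀ x₁ x₂ x₃`. -/
def normCell {α : Type} (Z : MCell) (k : MCell → α) : α :=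
  forcePt (Z 0) fun a => forcePt (Z 1) fun b => forcePt (Z 2) fun c => forcePt (Z 3) fun d => k (mcellOf a b c d)

theorem mcellOf_apply_eq (Z : MCell) : mcellOf (Z 0) (Z 1) (Z 2) (Z 3) = Z := by
  funext f; fin_cases f <;> rfl

theorem normCell_eq {α : Type} (Z : MCell) (k : MCell → α) : normCell Z k = k Z := by
  simp only [normCell, forcePt_eq, mcellOf_apply_eq]

/-- the `(cell, m)` of a transversal code `c = i·96 + s·4 + j`: `Δ^j (R_i ∘ σ_s)` with the multiplicity of representative `i`. -/
def genCell (reps : List (MCell × ℤ)) (c : ℕ) : MCell × ℤ :=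
  match reps[c / 96]?, permList[c % 96 / 4]? with
  | some (R, m), some σ => (deltaIter (c % 4) (R.perm σ), m)
  | _, _ => (fun _ => ((0 : ℤ), (0 : ℤ), (0 : ℤ)), 0)

/-- the `(cell, m)` list of a code list, every cell forced to literal form. -/
def genList (reps : List (MCell × ℤ)) : List ℕ → List (MCell × ℤ)
  | [] => []
  | c :: cs => match genCell reps c with | (Z, m) => normCell Z fun Z' => (Z', m) :: genList reps cs

theorem genList_eq (reps : List (MCell × ℤ)) (cs : List ℕ) : genList reps cs = cs.map (genCell reps) := by
  induction cs with
  | nil => rfl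
  | cons c cs ih => simp only [genList, normCell_eq, List.map_cons, ih]

/-- unpack `count` base-`B` digits of `n`, least significant first. -/
def unpack (B : ℕ) : ℕ → ℕ → List ℕ
  | 0, _ => []
  | count + 1, n => (n % B) :: unpack B count (n / B)

/-! ### §0.4 The search tree, the multiplicity function, closure and invariance -/

/-- binary search tree over `key`, carrying `(cell, m)`. -/
inductive CT : Type
  | nil : CT
  | node : CT → ℕ → MCell → ℤ → CT → CT

/-- lookup by key (sound for ANY tree: a hit is an entry). -/
def CT.find : CT → ℕ → Option (MCell × ℤ)
  | CT.nil, _ => none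
  | CT.node l k c m r, q =>
    match Nat.blt q k with
    | true => l.find q
    | false => match Nat.blt k q with
      | true => r.find q
      | false => some (c, m)

/-- in-order list of entries. -/
def CT.entries : CT → List (MCell × ℤ)
  | CT.nil => []
  | CT.node l _ c m r => l.entries ++ (c, m) :: r.entries

theorem CT.find_mem : ∀ (t : CT) (q : ℕ) (p : MCell × ℤ), t.find q = some p → p ∈ t.entries
  | CT.nil, q, p, h => by simp [CT.find] at h
  | CT.node l k c m r, q, p, h => by
    simp only [CT.entries, List.mem_append, List.mem_cons]
    unfold CT.find at h
    cases h1 : Nat.blt q k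
    · rw [h1] at h; simp only at h
      cases h2 : Nat.blt k q
      · rw [h2] at h; simp only [Option.some.injEq] at h; exact Or.inr (Or.inl h.symm)
      · rw [h2] at h; exact Or.inr (Or.inr (CT.find_mem r q p h))
    · rw [h1] at h; exact Or.inl (CT.find_mem l q p h)

/-- build a balanced tree from a key-sorted list (fuel = depth bound; correctness is not needed — soundness of `find` is). -/
def CT.build : ℕ → List (MCell × ℤ) → ℕ → CT × List (MCell × ℤ)
  | 0, l, _ => (CT.nil, l)
  | fuel + 1, l, n =>
    match n with
    | 0 => (CT.nil, l)
    | n' + 1 =>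
      match CT.build fuel l ((n' + 1) / 2) with
      | (lt, rest) =>
        match rest with
        | [] => (lt, [])
        | (c, m) :: rest' =>
          match CT.build fuel rest' (n' - (n' + 1) / 2) with
          | (rt, rest'') => (CT.node lt (key c) c m rt, rest'')

/-- the tree of a key-sorted `(cell, m)` list. -/
def treeOf (L : List (MCell × ℤ)) : CT := (CT.build 64 L L.length).1

/-- THE MULTIPLICITY FUNCTION of a tree: the stored multiplicity if the stored cell IS the query, else `0`. -/
def mT (t : CT) (Z : MCell) : ℤ :=
  match t.find (key Z) with
  | some (c, m) => match decide (c = Z) with | true => m | false => 0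
  | none => 0

/-- soundness: a non-zero value is a stored entry for the query cell. -/
theorem mT_entry {t : CT} {Z : MCell} (h : mT t Z ≠ 0) : (Z, mT t Z) ∈ t.entries := by
  unfold mT at h ⊢
  cases hf : t.find (key Z) with
  | none => rw [hf] at h; exact absurd rfl h
  | some p =>
    obtain ⟨c, m⟩ := p
    rw [hf] at h
    by_cases hcZ : c = Z
    · subst hcZ
      simp only
      exact CT.find_mem t _ _ hf
    · have hc : decide (c = Z) = false := decide_eq_false hcZ
      simp only [hc] at h
      exact absurd rfl h

/-- `S₄`-invariance of a multiplicity function, as a predicate on `σ`. -/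
def PInv (m : MCell → ℤ) (σ : Equiv.Perm (Fin 4)) : Prop := ∀ Z, m (Z.perm σ) = m Z

theorem pInv_one (m : MCell → ℤ) : PInv m 1 := fun Z => by rw [MCell.perm_one]

theorem pInv_mul {m : MCell → ℤ} {σ τ : Equiv.Perm (Fin 4)} (hσ : PInv m σ) (hτ : PInv m τ) : PInv m (σ * τ) := fun Z => by
  rw [MCell.perm_mul, hτ, hσ]

/-- every transposition of `Fin 4` is pointwise one of `(01) (12) (23) (02) (13) (03)`. [`decide`] -/
theorem swap_cases : ∀ x y : Fin 4, x ≠ y →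
    (∀ z, Equiv.swap x y z = Equiv.swap 0 1 z) ∨ (∀ z, Equiv.swap x y z = Equiv.swap 1 2 z) ∨ (∀ z, Equiv.swap x y z = Equiv.swap 2 3 z) ∨
    (∀ z, Equiv.swap x y z = Equiv.swap 0 2 z) ∨ (∀ z, Equiv.swap x y z = Equiv.swap 1 3 z) ∨ (∀ z, Equiv.swap x y z = Equiv.swap 0 3 z) := by
  decide

/-- `S₄`-invariance from invariance under the three adjacent transpositions. -/
theorem pInv_all {m : MCell → ℤ} (h01 : PInv m (Equiv.swap 0 1)) (h12 : PInv m (Equiv.swap 1 2)) (h23 : PInv m (Equiv.swap 2 3)) :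
    ∀ σ, PInv m σ := by
  have e02 : Equiv.swap (0 : Fin 4) 2 = Equiv.swap 0 1 * Equiv.swap 1 2 * Equiv.swap 0 1 := Equiv.ext (by decide)
  have e13 : Equiv.swap (1 : Fin 4) 3 = Equiv.swap 1 2 * Equiv.swap 2 3 * Equiv.swap 1 2 := Equiv.ext (by decide)
  have e03 : Equiv.swap (0 : Fin 4) 3 = Equiv.swap 0 1 * Equiv.swap 1 3 * Equiv.swap 0 1 := Equiv.ext (by decide)
  have h02 : PInv m (Equiv.swap 0 2) := by rw [e02]; exact pInv_mul (pInv_mul h01 h12) h01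
  have h13 : PInv m (Equiv.swap 1 3) := by rw [e13]; exact pInv_mul (pInv_mul h12 h23) h12
  have h03 : PInv m (Equiv.swap 0 3) := by rw [e03]; exact pInv_mul (pInv_mul h01 h13) h01
  have hsw : ∀ x y : Fin 4, x ≠ y → PInv m (Equiv.swap x y) := by
    intro x y hxy
    rcases swap_cases x y hxy with e | e | e | e | e | e <;> rw [Equiv.ext e]
    exacts [h01, h12, h23, h02, h13, h03]
  intro σ
  induction σ using Equiv.Perm.swap_induction_on with
  | one => exact pInv_one m
  | swap_mul τ x y hxy ih => exact pInv_mul (hsw x y hxy) ih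

/-- the three adjacent transpositions as explicit table permutations (cheap to apply in the kernel). -/
def sw01 : Equiv.Perm (Fin 4) := mkPerm ![1, 0, 2, 3] ![1, 0, 2, 3] (by decide) (by decide)
/-- see `sw01`. -/
def sw12 : Equiv.Perm (Fin 4) := mkPerm ![0, 2, 1, 3] ![0, 2, 1, 3] (by decide) (by decide)
/-- see `sw01`. -/
def sw23 : Equiv.Perm (Fin 4) := mkPerm ![0, 1, 3, 2] ![0, 1, 3, 2] (by decide) (by decide)

theorem sw01_eq : sw01 = Equiv.swap 0 1 := Equiv.ext (by decide)
theorem sw12_eq : sw12 = Equiv.swap 1 2 := Equiv.ext (by decide)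
theorem sw23_eq : sw23 = Equiv.swap 2 3 := Equiv.ext (by decide)

/-- the per-entry CLOSURE CHECK of a level: the entry's own lookup, its three adjacent transposition images and its `Δ`-image all return
the entry's multiplicity. -/
def closureCheck (t : CT) (p : MCell × ℤ) : Bool :=
  decide (mT t p.1 = p.2) && decide (mT t (p.1.perm sw01) = p.2) && decide (mT t (p.1.perm sw12) = p.2) &&
    decide (mT t (p.1.perm sw23) = p.2) && decide (mT t p.1.delta = p.2)

/-- what the closure check says. -/
theorem closureCheck_spec {t : CT} {p : MCell × ℤ} (h : closureCheck t p = true) :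
    mT t p.1 = p.2 ∧ mT t (p.1.perm (Equiv.swap 0 1)) = p.2 ∧ mT t (p.1.perm (Equiv.swap 1 2)) = p.2 ∧
      mT t (p.1.perm (Equiv.swap 2 3)) = p.2 ∧ mT t p.1.delta = p.2 := by
  simp only [closureCheck, Bool.and_eq_true, decide_eq_true_eq, sw01_eq, sw12_eq, sw23_eq] at h
  exact ⟨h.1.1.1.1, h.1.1.1.2, h.1.1.2, h.1.2, h.2⟩

/-- A CERTIFIED LEVEL: a `(cell, m)` list `L` and a tree `t` with `t.entries = L`, all multiplicities positive, every entry passing the closure check. -/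
structure LevelCert (L : List (MCell × ℤ)) (t : CT) : Prop where
  entries : t.entries = L
  pos : ∀ p ∈ L, 0 < p.2
  closed : ∀ p ∈ L, closureCheck t p = true

namespace LevelCert

variable {L : List (MCell × ℤ)} {t : CT}

theorem agree (h : LevelCert L t) : ∀ p ∈ L, mT t p.1 = p.2 := fun p hp => (closureCheck_spec (h.closed p hp)).1

theorem entry_of_ne (h : LevelCert L t) {Z : MCell} (hZ : mT t Z ≠ 0) : (Z, mT t Z) ∈ L := h.entries ▸ mT_entry hZ

theorem ne_zero_iff_mem (h : LevelCert L t) (Z : MCell) : mT t Z ≠ 0 ↔ Z ∈ L.map Prod.fst := by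
  constructor
  · intro hZ; exact List.mem_map.2 ⟨_, h.entry_of_ne hZ, rfl⟩
  · rintro hZ
    obtain ⟨p, hp, rfl⟩ := List.mem_map.1 hZ
    rw [h.agree p hp]; exact (h.pos p hp).ne'

/-- on the support the multiplicity function takes the listed (non-zero) values, so a closure equation transports. -/
theorem transport (h : LevelCert L t) (g : MCell → MCell) (hcl : ∀ p ∈ L, mT t (g p.1) = p.2) (W : MCell) (hW : mT t W ≠ 0) :
    mT t (g W) = mT t W := by
  have e := hcl (W, mT t W) (h.entry_of_ne hW)
  exact e

/-- invariance under an involution `s` checked on the entries (for ALL cells). -/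
theorem pInv_of_check (h : LevelCert L t) (s : Equiv.Perm (Fin 4)) (hs : s * s = 1)
    (hcl : ∀ p ∈ L, mT t (p.1.perm s) = p.2) : PInv (mT t) s := by
  have hinv : ∀ Z : MCell, (Z.perm s).perm s = Z := fun Z => by rw [← MCell.perm_mul, hs, MCell.perm_one]
  intro Z
  by_cases hZ : mT t Z = 0
  · rw [hZ]
    by_contra hne
    have h1 := h.transport (fun W => W.perm s) hcl (Z.perm s) hne
    simp only [hinv] at h1
    rw [hZ] at h1
    exact hne h1.symm
  · exact h.transport (fun W => W.perm s) hcl Z hZ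

/-- **GLOBAL `S₄`-INVARIANCE of the multiplicity function.** -/
theorem pInv (h : LevelCert L t) : ∀ σ Z, mT t (MCell.perm σ Z) = mT t Z :=
  pInv_all
    (h.pInv_of_check (Equiv.swap 0 1) (Equiv.swap_mul_self 0 1) fun p hp => (closureCheck_spec (h.closed p hp)).2.1)
    (h.pInv_of_check (Equiv.swap 1 2) (Equiv.swap_mul_self 1 2) fun p hp => (closureCheck_spec (h.closed p hp)).2.2.1)
    (h.pInv_of_check (Equiv.swap 2 3) (Equiv.swap_mul_self 2 3) fun p hp => (closureCheck_spec (h.closed p hp)).2.2.2.1)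

/-- **GLOBAL `Δ`-INVARIANCE of the multiplicity function.** -/
theorem dInv (h : LevelCert L t) : ∀ Z, mT t Z.delta = mT t Z := by
  have hcl : ∀ p ∈ L, mT t p.1.delta = p.2 := fun p hp => (closureCheck_spec (h.closed p hp)).2.2.2.2
  have tr := h.transport MCell.delta hcl
  intro Z
  by_cases hZ : mT t Z = 0
  · rw [hZ]
    by_contra hne
    have h1 : mT t Z.delta.delta = mT t Z.delta := tr _ hne
    have h2 : mT t Z.delta.delta.delta = mT t Z.delta.delta := tr _ (by rw [h1]; exact hne)
    have h3 : mT t Z.delta.delta.delta.delta = mT t Z.delta.delta.delta := tr _ (by rw [h2, h1]; exact hne)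
    rw [MCell.delta_four, h2, h1, hZ] at h3
    exact hne h3.symm
  · exact tr Z hZ

theorem nodup_of (hk : ((L.map Prod.fst).map key).IsChain (· < ·)) : (L.map Prod.fst).Nodup := nodup_of_keys key hk

/-- the level is `S₄`-closed. -/
theorem permClosed (h : LevelCert L t) (hL : (L.map Prod.fst).Nodup) : PermClosed (levelOf L hL) := by
  intro σ Z hZ
  rw [mem_levelOf] at hZ ⊢
  rw [← h.ne_zero_iff_mem] at hZ ⊢
  rwa [h.pInv σ Z]

/-- the level is `Δ`-closed. -/
theorem deltaClosed (h : LevelCert L t) (hL : (L.map Prod.fst).Nodup) : DeltaClosed (levelOf L hL) := by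
  intro Z hZ
  rw [mem_levelOf] at hZ ⊢
  rw [← h.ne_zero_iff_mem] at hZ ⊢
  rwa [h.dInv Z]

end LevelCert

/-- `LevelCert` from the three decided Booleans. -/
theorem levelCert_of (L : List (MCell × ℤ)) (t : CT) (h1 : t.entries = L) (h2 : allB L (fun p => decide (0 < p.2)) = true)
    (h3 : allB L (closureCheck t) = true) : LevelCert L t :=
  ⟨h1, forall_of_allB h2, (allB_iff L _).1 h3⟩

/-! ### §0.5 The class screen from 22 word representatives -/

/-- merge the letter `v` into `u` (`bphi x 2 = bphi x 1 = α`). -/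
def uvNorm (w : CWord) : CWord := fun f => if w f = 2 then 1 else w f

theorem bphi_uv (x : BPoint) (l : Fin 6) : bphi x (if l = 2 then 1 else l) = bphi x l := by
  by_cases h : l = 2
  · subst h; simp [bphi, phiVec]
  · rw [if_neg h]

theorem ch_uvNorm (Z : MCell) (w : CWord) : Z.ch (uvNorm w) = Z.ch w := by
  simp only [MCell.ch, chTensor, uvNorm, bphi_uv]

theorem wch_uvNorm (C : MConfig) (mN mP : MCell → ℤ) (w : CWord) : C.wch mN mP (uvNorm w) = C.wch mN mP w := by
  simp only [MConfig.wch, Pi.sub_apply, Finset.sum_apply, Pi.smul_apply, ch_uvNorm]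

theorem ldeg_uv (l : Fin 6) : ldeg (if l = 2 then 1 else l) = ldeg l := by
  by_cases h : l = 2
  · subst h; decide
  · rw [if_neg h]

theorem wdeg_uvNorm (w : CWord) : wdeg (uvNorm w) = wdeg w := by
  simp only [wdeg, uvNorm, ldeg_uv]

/-- the 7 e-MIXED word representatives with `n_e = n_ē` (letters `0,1,3,4,5 = 1,u,e,ē,p`): `eē11, eē1u, eē1p, eēuu, eēup, eēpp, eeēē`. -/
def mixedReps : List CWord :=
  [![3, 4, 0, 0], ![3, 4, 0, 1], ![3, 4, 0, 5], ![3, 4, 1, 1], ![3, 4, 1, 5], ![3, 4, 5, 5], ![3, 3, 4, 4]]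

/-- the 15 e-FREE word representatives (multisets of size 4 from `{1, u, p}`). -/
def freeReps : List CWord :=
  [![0, 0, 0, 0], ![1, 0, 0, 0], ![1, 1, 0, 0], ![1, 1, 1, 0], ![1, 1, 1, 1], ![5, 0, 0, 0], ![5, 1, 0, 0], ![5, 1, 1, 0],
   ![5, 1, 1, 1], ![5, 5, 0, 0], ![5, 5, 1, 0], ![5, 5, 1, 1], ![5, 5, 5, 0], ![5, 5, 5, 1], ![5, 5, 5, 5]]

/-- Boolean cover test: some `S₄`-rearrangement of the `u`~`v`-merged word is one of the representatives. -/
def coverB (reps : List CWord) (w : CWord) : Bool :=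
  permList.any fun σ => reps.any fun r => decide (r = permW σ (uvNorm w))

theorem cover_of_coverB {reps : List CWord} {w : CWord} (h : coverB reps w = true) : ∃ σ ∈ permList, permW σ (uvNorm w) ∈ reps := by
  simp only [coverB, List.any_eq_true, decide_eq_true_eq] at h
  obtain ⟨σ, hσ, r, hr, rfl⟩ := h
  exact ⟨σ, hσ, hr⟩

/-- WORD-ORBIT COVER, mixed part: every e-mixed word other than `eeee`, `ēēēē` with trivial Δ-twist is, after `u`~`v` merging, an
`S₄`-rearrangement of one of the 7 mixed representatives. [kernel, `decide`] -/
theorem mixed_coverB : ∀ w : CWord, ¬ EFree w → w ≠ eWord → w ≠ ebarWord → wtwExp w % 4 = 0 → coverB mixedReps w = true := by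
  decide +kernel

theorem mixed_cover (w : CWord) (h1 : ¬ EFree w) (h2 : w ≠ eWord) (h3 : w ≠ ebarWord) (h4 : wtwExp w % 4 = 0) :
    ∃ σ ∈ permList, permW σ (uvNorm w) ∈ mixedReps := cover_of_coverB (mixed_coverB w h1 h2 h3 h4)

/-- WORD-ORBIT COVER, free part: every e-free word is, after `u`~`v` merging, an `S₄`-rearrangement of one of the 15 free
representatives. [kernel, `decide`] -/
theorem free_coverB : ∀ w : CWord, EFree w → coverB freeReps w = true := by
  decide +kernel

theorem free_cover (w : CWord) (h : EFree w) : ∃ σ ∈ permList, permW σ (uvNorm w) ∈ freeReps := cover_of_coverB (free_coverB w h)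

/-- **(A1) FROM 22 REPRESENTATIVE WORDS.** On a `G₁`-closed support with `G₁`-invariant multiplicities, the weighted class tensor passes
the class screen as soon as the 7 mixed representatives vanish and the 15 free representatives depend only on the degree. -/
theorem classScreen_of_reps (C : MConfig) (mN mP : MCell → ℤ)
    (hlP : PermClosed C.lower) (huP : PermClosed C.upper) (hlD : DeltaClosed C.lower) (huD : DeltaClosed C.upper)
    (hNσ : ∀ σ Z, mN (MCell.perm σ Z) = mN Z) (hPσ : ∀ σ P, mP (MCell.perm σ P) = mP P)
    (hNΔ : ∀ Z, mN Z.delta = mN Z) (hPΔ : ∀ P, mP P.delta = mP P) (q : ℕ → GaussianInt)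
    (hmixed : ∀ r ∈ mixedReps, C.wch mN mP r = 0) (hfree : ∀ r ∈ freeReps, C.wch mN mP r = q (wdeg r)) :
    ClassScreen (C.wch mN mP) := by
  have hval : ∀ w, EFree w → C.wch mN mP w = q (wdeg w) := by
    intro w hw
    obtain ⟨σ, -, hr⟩ := free_cover w hw
    rw [← wch_uvNorm, ← C.wch_permW_of_permInvariant hlP huP mN mP hNσ hPσ σ (uvNorm w), hfree _ hr, wdeg_permW, wdeg_uvNorm]
  refine ⟨fun w h1 h2 h3 => ?_, fun w w' hw hw' hd => by rw [hval w hw, hval w' hw', hd]⟩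
  by_cases ht : wtwExp w % 4 = 0
  · obtain ⟨σ, -, hr⟩ := mixed_cover w h1 h2 h3 ht
    rw [← wch_uvNorm, ← C.wch_permW_of_permInvariant hlP huP mN mP hNσ hPσ σ (uvNorm w), hmixed _ hr]
  · exact C.wch_eq_zero_of_deltaInvariant hlD huD mN mP hNΔ hPΔ w (by rw [Ne, twistW_eq_one_iff]; exact ht)

/-! ### §0.6 The certified design: everything assembled -/

/-- A CERTIFIED DESIGN: two certified levels with key-sorted cell lists. -/
structure DesignCert (LN LP : List (MCell × ℤ)) (tN tP : CT) : Prop where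
  certN : LevelCert LN tN
  certP : LevelCert LP tP
  keysN : ((LN.map Prod.fst).map key).IsChain (· < ·)
  keysP : ((LP.map Prod.fst).map key).IsChain (· < ·)

namespace DesignCert

variable {LN LP : List (MCell × ℤ)} {tN tP : CT}

theorem nodupN (h : DesignCert LN LP tN tP) : (LN.map Prod.fst).Nodup := nodup_of_keys key h.keysN
theorem nodupP (h : DesignCert LN LP tN tP) : (LP.map Prod.fst).Nodup := nodup_of_keys key h.keysP

/-- the configuration of the certified design. -/
def cfg (h : DesignCert LN LP tN tP) : MConfig := cfgOf LN LP h.nodupN h.nodupP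

theorem cfg_lower (h : DesignCert LN LP tN tP) : h.cfg.lower = levelOf LN h.nodupN := rfl
theorem cfg_upper (h : DesignCert LN LP tN tP) : h.cfg.upper = levelOf LP h.nodupP := rfl
theorem mem_lower (h : DesignCert LN LP tN tP) {Z : MCell} : Z ∈ h.cfg.lower ↔ Z ∈ LN.map Prod.fst := Iff.rfl
theorem mem_upper (h : DesignCert LN LP tN tP) {P : MCell} : P ∈ h.cfg.upper ↔ P ∈ LP.map Prod.fst := Iff.rfl

/-- the support is `G₁`-closed: both levels `S₄`-closed and `Δ`-closed. -/
theorem g1 (h : DesignCert LN LP tN tP) :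
    PermClosed h.cfg.lower ∧ PermClosed h.cfg.upper ∧ DeltaClosed h.cfg.lower ∧ DeltaClosed h.cfg.upper :=
  ⟨h.certN.permClosed h.nodupN, h.certP.permClosed h.nodupP, h.certN.deltaClosed h.nodupN, h.certP.deltaClosed h.nodupP⟩

/-- the weighted class tensor of the certified design IS the raw evaluator. -/
theorem wch_eq (h : DesignCert LN LP tN tP) (w : CWord) : h.cfg.wch (mT tN) (mT tP) w = toG (rawT LN LP w) :=
  wch_eq_raw LN LP h.nodupN h.nodupP (mT tN) (mT tP) h.certN.agree h.certP.agree w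

/-- **(A1) for the certified design from the 22 raw word checks.** -/
theorem classScreen (h : DesignCert LN LP tN tP) (qr : ℕ → ℤ × ℤ)
    (hmixed : ∀ r ∈ mixedReps, rawT LN LP r = (0, 0)) (hfree : ∀ r ∈ freeReps, rawT LN LP r = qr (wdeg r)) :
    ClassScreen (h.cfg.wch (mT tN) (mT tP)) := by
  obtain ⟨h1, h2, h3, h4⟩ := h.g1
  refine classScreen_of_reps h.cfg (mT tN) (mT tP) h1 h2 h3 h4 h.certN.pInv h.certP.pInv h.certN.dInv h.certP.dInv
    (fun k => toG (qr k)) (fun r hr => ?_) (fun r hr => ?_)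
  · rw [h.wch_eq, hmixed r hr]; rfl
  · rw [h.wch_eq, hfree r hr]

/-- **μ** of the certified design from the raw check at `eeee`. -/
theorem mu (h : DesignCert LN LP tN tP) (a b : ℤ) (he : rawT LN LP eWord = (a, b)) : h.cfg.wch (mT tN) (mT tP) eWord = ⟨a, b⟩ := by
  rw [h.wch_eq, he]; rfl

/-- **RANK** of the certified design: `Σ m_N − Σ m_P` from the two accumulator totals. -/
theorem rank (h : DesignCert LN LP tN tP) :
    ((∑ Z ∈ h.cfg.lower, mT tN Z) - ∑ P ∈ h.cfg.upper, mT tP P : ℤ) = msum LN 0 - msum LP 0 := by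
  rw [cfg_lower, cfg_upper, sum_level_m LN h.nodupN _ h.certN.agree, sum_level_m LP h.nodupP _ h.certP.agree]

/-- every multiplicity is positive on the support and zero off it. -/
theorem mult_pos (h : DesignCert LN LP tN tP) :
    (∀ Z ∈ h.cfg.lower, 0 < mT tN Z) ∧ (∀ P ∈ h.cfg.upper, 0 < mT tP P) ∧
      (∀ Z, Z ∉ h.cfg.lower → mT tN Z = 0) ∧ (∀ P, P ∉ h.cfg.upper → mT tP P = 0) := by
  refine ⟨fun Z hZ => ?_, fun P hP => ?_, fun Z hZ => ?_, fun P hP => ?_⟩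
  · obtain ⟨p, hp, rfl⟩ := List.mem_map.1 (h.mem_lower.1 hZ); rw [h.certN.agree p hp]; exact h.certN.pos p hp
  · obtain ⟨p, hp, rfl⟩ := List.mem_map.1 (h.mem_upper.1 hP); rw [h.certP.agree p hp]; exact h.certP.pos p hp
  · by_contra hne; exact hZ (h.mem_lower.2 ((h.certN.ne_zero_iff_mem Z).1 hne))
  · by_contra hne; exact hP (h.mem_upper.2 ((h.certP.ne_zero_iff_mem P).1 hne))

end DesignCert

/-- `DesignCert` from six decided Booleans. -/
theorem designCert_of (LN LP : List (MCell × ℤ)) (tN tP : CT)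
    (h1 : tN.entries = LN) (h2 : allB LN (fun p => decide (0 < p.2)) = true) (h3 : allB LN (closureCheck tN) = true)
    (h4 : tP.entries = LP) (h5 : allB LP (fun p => decide (0 < p.2)) = true) (h6 : allB LP (closureCheck tP) = true)
    (h7 : chainB ((LN.map Prod.fst).map key) = true) (h8 : chainB ((LP.map Prod.fst).map key) = true) : DesignCert LN LP tN tP :=
  ⟨levelCert_of LN tN h1 h2 h3, levelCert_of LP tP h4 h5 h6, isChain_of_chainB _ h7, isChain_of_chainB _ h8⟩

/-! ### §0.7 Orbit transport of the static families of record (tree covariance: `Pad4TowerPermCovariance(Static)`, `Pad4TowerTorusBlind(Base)`) -/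

/-- a perm-closed configuration is its own permutation image. -/
theorem permImage_eq_of_permClosed (C : MConfig) (hl : PermClosed C.lower) (hu : PermClosed C.upper) (τ : Equiv.Perm (Fin 4)) :
    C.permImage τ = C := by
  obtain ⟨lo, up⟩ := C
  show MConfig.mk _ _ = _
  rw [image_perm_eq _ hl, image_perm_eq _ hu]

/-- a Δ-closed configuration is its own `dVec` phase image. -/
theorem phaseImage_eq_of_deltaClosed (C : MConfig) (hl : DeltaClosed C.lower) (hu : DeltaClosed C.upper) :
    C.phaseImage dVec = C := MConfig.phaseImage_dVec_of_deltaClosed C hl hu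

/-- a `G₁`-closed configuration (the four closure facts). -/
abbrev G1C (C : MConfig) : Prop := PermClosed C.lower ∧ PermClosed C.upper ∧ DeltaClosed C.lower ∧ DeltaClosed C.upper

/-! ### RULE D -/

theorem ruleDMu4N_perm_of (C : MConfig) (hG : G1C C) (τ : Equiv.Perm (Fin 4)) (Z : MCell) (h : RuleDMu4N C Z) : RuleDMu4N C (Z.perm τ) := by
  have e := ruleDMu4N_perm τ C Z
  rw [permImage_eq_of_permClosed C hG.1 hG.2.1] at e
  exact e.2 h

theorem ruleDMu4N_delta_of (C : MConfig) (hG : G1C C) (Z : MCell) (h : RuleDMu4N C Z) : RuleDMu4N C Z.delta := by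
  have e := ruleDMu4N_phase dVec C Z
  rw [phaseImage_eq_of_deltaClosed C hG.2.2.1 hG.2.2.2, MCell.phase_dVec] at e
  exact e.2 h

theorem ruleDMu4N_orbit (C : MConfig) (hG : G1C C) (R : MCell) (h : RuleDMu4N C R) (τ : Equiv.Perm (Fin 4)) :
    ∀ j, RuleDMu4N C (deltaIter j (R.perm τ))
  | 0 => ruleDMu4N_perm_of C hG τ R h
  | j + 1 => ruleDMu4N_delta_of C hG _ (ruleDMu4N_orbit C hG R h τ j)

theorem ruleDMu4P_perm_of (C : MConfig) (hG : G1C C) (τ : Equiv.Perm (Fin 4)) (P : MCell) (h : RuleDMu4P C P) : RuleDMu4P C (P.perm τ) := by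
  have e := ruleDMu4P_perm τ C P
  rw [permImage_eq_of_permClosed C hG.1 hG.2.1] at e
  exact e.2 h

theorem ruleDMu4P_delta_of (C : MConfig) (hG : G1C C) (P : MCell) (h : RuleDMu4P C P) : RuleDMu4P C P.delta := by
  have e := ruleDMu4P_phase dVec C P
  rw [phaseImage_eq_of_deltaClosed C hG.2.2.1 hG.2.2.2, MCell.phase_dVec] at e
  exact e.2 h

theorem ruleDMu4P_orbit (C : MConfig) (hG : G1C C) (R : MCell) (h : RuleDMu4P C R) (τ : Equiv.Perm (Fin 4)) :
    ∀ j, RuleDMu4P C (deltaIter j (R.perm τ))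
  | 0 => ruleDMu4P_perm_of C hG τ R h
  | j + 1 => ruleDMu4P_delta_of C hG _ (ruleDMu4P_orbit C hG R h τ j)

/-! ### the X family, head-wise -/

theorem dVec_apply (σ : Fin 4) : dVec σ = 1 := by revert σ; decide

theorem dsh_one_three (u : Fin 4) : dsh 1 (dsh 3 u) = u := by revert u; decide

/-- the X family holds AT THE HEAD `Z` (all partners, siblings, indices). -/
abbrev XHead (D : MConfig) (Z : MCell) : Prop := ∀ q ∈ D.upper, ∀ n ∈ D.lower, ∀ σ u w f : Fin 4, ¬ XresXFires D Z q n σ u w f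

/-- GUARDED form of the head predicate (what the kernel decides): quantifiers reordered so that each factor `σ` costs ONE scan of the partner level
(agreement off `σ` first, then the direction) and each partner ONE scan of the sibling level; apex factors pruned first. Same content as `XHead`. -/
abbrev XHeadG (D : MConfig) (Z : MCell) : Prop :=
  ∀ σ : Fin 4, ¬ isApex (Z σ) → ∀ q ∈ D.upper, MAgree q Z σ → ∀ u : Fin 4, UPartner Z q σ u →
    ∀ n ∈ D.lower, MAgree n q σ → ∀ w : Fin 4, Sibling q n σ w → ∀ f : Fin 4, ¬ XresXFires D Z q n σ u w f

theorem xHead_of_guarded {D : MConfig} {Z : MCell} (h : XHeadG D Z) : XHead D Z :=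
  fun q hq n hn σ u w f hF => h σ hF.1 q hq hF.2.2.1.1 u hF.2.2.1 n hn hF.2.2.2.2.2.1.1 w hF.2.2.2.2.2.1 f hF

theorem xresXClosed_of_heads {D : MConfig} (h : ∀ Z ∈ D.lower, XHead D Z) : XresXClosed D :=
  fun Z hZ q hq n hn σ u w f => h Z hZ q hq n hn σ u w f

theorem xHead_perm_of (D : MConfig) (hG : G1C D) (τ : Equiv.Perm (Fin 4)) (Z : MCell) (h : XHead D Z) : XHead D (Z.perm τ) := by
  intro q hq n hn σ u w f hF
  have hq' : q.perm τ⁻¹ ∈ D.upper := hG.2.1 _ q hq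
  have hn' : n.perm τ⁻¹ ∈ D.lower := hG.1 _ n hn
  have e := xresXFires_perm τ D Z (q.perm τ⁻¹) (n.perm τ⁻¹) σ u w f
  rw [permImage_eq_of_permClosed D hG.1 hG.2.1, MCell.perm_inv_perm, MCell.perm_inv_perm] at e
  exact h _ hq' _ hn' _ _ _ _ (e.1 hF)

theorem xHead_delta_of (D : MConfig) (hG : G1C D) (Z : MCell) (h : XHead D Z) : XHead D Z.delta := by
  intro q hq n hn σ u w f hF
  have hq' : q.delta.delta.delta ∈ D.upper := (DeltaClosed.iter hG.2.2.2 _ (hG.2.2.2 q hq)).1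
  have hn' : n.delta.delta.delta ∈ D.lower := (DeltaClosed.iter hG.2.2.1 _ (hG.2.2.1 n hn)).1
  obtain ⟨u', rfl⟩ : ∃ u', u = dsh (dVec σ) u' := ⟨dsh 3 u, by rw [dVec_apply, dsh_one_three]⟩
  obtain ⟨w', rfl⟩ : ∃ w', w = dsh (dVec σ) w' := ⟨dsh 3 w, by rw [dVec_apply, dsh_one_three]⟩
  have e := xresXFires_phase dVec D Z q.delta.delta.delta n.delta.delta.delta σ u' w' f
  rw [phaseImage_eq_of_deltaClosed D hG.2.2.1 hG.2.2.2, MCell.phase_dVec, MCell.phase_dVec, MCell.phase_dVec,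
    MCell.delta_four, MCell.delta_four] at e
  exact h _ hq' _ hn' _ _ _ _ (e.1 hF)

theorem xHead_orbit (D : MConfig) (hG : G1C D) (R : MCell) (h : XHead D R) (τ : Equiv.Perm (Fin 4)) :
    ∀ j, XHead D (deltaIter j (R.perm τ))
  | 0 => xHead_perm_of D hG τ R h
  | j + 1 => xHead_delta_of D hG _ (xHead_orbit D hG R h τ j)

/-! ### the A2I family, head-wise -/

/-- the A2I family holds AT THE HEAD `Z`. -/
abbrev AHead (D : MConfig) (Z : MCell) : Prop := ∀ q ∈ D.upper, ∀ N' ∈ D.lower, ∀ σ u f' v : Fin 4, ¬ XresA2IFires D Z q N' σ u f' v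

/-- GUARDED form (what the kernel decides): apex factors pruned, agreement off `σ` before the direction, the server level scanned ONCE per partner with
agreement off `f'` before the direction `v`. Same content as `AHead`. -/
abbrev AHeadG (D : MConfig) (Z : MCell) : Prop :=
  ∀ σ : Fin 4, ¬ isApex (Z σ) → ∀ q ∈ D.upper, MAgree q Z σ → ∀ u : Fin 4, EncDir (Z σ) u → UPartner Z q σ u →
    ∀ N' ∈ D.lower, ∀ f' : Fin 4, f' ≠ σ → MAgree q N' f' → ∀ v : Fin 4, UPartner N' q f' v → ¬ XresA2IFires D Z q N' σ u f' v

theorem aHead_of_guarded {D : MConfig} {Z : MCell} (h : AHeadG D Z) : AHead D Z :=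
  fun q hq N' hN σ u f' v hF =>
    h σ hF.1 q hq hF.2.2.1.1 u hF.2.1 hF.2.2.1 N' hN f' hF.2.2.2.2.1 hF.2.2.2.2.2.1.1 v hF.2.2.2.2.2.1 hF

theorem xresA2IClosed_of_heads {D : MConfig} (h : ∀ Z ∈ D.lower, AHead D Z) : XresA2IClosed D :=
  fun Z hZ q hq N' hN σ u f' v => h Z hZ q hq N' hN σ u f' v

theorem aHead_perm_of (D : MConfig) (hG : G1C D) (τ : Equiv.Perm (Fin 4)) (Z : MCell) (h : AHead D Z) : AHead D (Z.perm τ) := by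
  intro q hq N' hN σ u f' v hF
  have hq' : q.perm τ⁻¹ ∈ D.upper := hG.2.1 _ q hq
  have hN'' : N'.perm τ⁻¹ ∈ D.lower := hG.1 _ N' hN
  have e := xresA2IFires_perm τ D Z (q.perm τ⁻¹) (N'.perm τ⁻¹) σ u f' v
  rw [permImage_eq_of_permClosed D hG.1 hG.2.1, MCell.perm_inv_perm, MCell.perm_inv_perm] at e
  exact h _ hq' _ hN'' _ _ _ _ (e.1 hF)

theorem aHead_delta_of (D : MConfig) (hG : G1C D) (Z : MCell) (h : AHead D Z) : AHead D Z.delta := by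
  intro q hq N' hN σ u f' v hF
  have hq' : q.delta.delta.delta ∈ D.upper := (DeltaClosed.iter hG.2.2.2 _ (hG.2.2.2 q hq)).1
  have hN'' : N'.delta.delta.delta ∈ D.lower := (DeltaClosed.iter hG.2.2.1 _ (hG.2.2.1 N' hN)).1
  obtain ⟨u', rfl⟩ : ∃ u', u = dsh (dVec σ) u' := ⟨dsh 3 u, by rw [dVec_apply, dsh_one_three]⟩
  obtain ⟨v', rfl⟩ : ∃ v', v = dsh (dVec f') v' := ⟨dsh 3 v, by rw [dVec_apply, dsh_one_three]⟩
  have e := xresA2IFires_phase dVec D Z q.delta.delta.delta N'.delta.delta.delta σ u' f' v'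
  rw [phaseImage_eq_of_deltaClosed D hG.2.2.1 hG.2.2.2, MCell.phase_dVec, MCell.phase_dVec, MCell.phase_dVec,
    MCell.delta_four, MCell.delta_four] at e
  exact h _ hq' _ hN'' _ _ _ _ (e.1 hF)

theorem aHead_orbit (D : MConfig) (hG : G1C D) (R : MCell) (h : AHead D R) (τ : Equiv.Perm (Fin 4)) :
    ∀ j, AHead D (deltaIter j (R.perm τ))
  | 0 => aHead_perm_of D hG τ R h
  | j + 1 => aHead_delta_of D hG _ (aHead_orbit D hG R h τ j)

/-! ### the dual world commutes with the action -/

theorem dualCell_deltaIter_perm (R : MCell) (τ : Equiv.Perm (Fin 4)) : ∀ j, dualCell 0 (deltaIter j (R.perm τ)) = deltaIter j ((dualCell 0 R).perm τ)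
  | 0 => rfl
  | j + 1 => by
    show dualCell 0 (deltaIter j (R.perm τ)).delta = (deltaIter j ((dualCell 0 R).perm τ)).delta
    rw [← dualCell_deltaIter_perm R τ j, ← MCell.phase_dVec, ← MCell.phase_dVec, dualCell_phase]

theorem permClosed_image_dual {S : Finset MCell} (h : PermClosed S) : PermClosed (S.image (dualCell 0)) := by
  intro σ Z hZ
  obtain ⟨W, hW, rfl⟩ := Finset.mem_image.1 hZ
  exact Finset.mem_image.2 ⟨W.perm σ, h σ W hW, rfl⟩

theorem deltaClosed_image_dual {S : Finset MCell} (h : DeltaClosed S) : DeltaClosed (S.image (dualCell 0)) := by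
  intro Z hZ
  obtain ⟨W, hW, rfl⟩ := Finset.mem_image.1 hZ
  refine Finset.mem_image.2 ⟨W.delta, h W hW, ?_⟩
  rw [← MCell.phase_dVec, ← MCell.phase_dVec, dualCell_phase]

theorem g1C_dual {C : MConfig} (hG : G1C C) : G1C (C.dual 0) :=
  ⟨permClosed_image_dual hG.2.1, permClosed_image_dual hG.1, deltaClosed_image_dual hG.2.2.2, deltaClosed_image_dual hG.2.2.1⟩

/-! ### §0.8 Static families from orbit representatives (assembly) -/

/-- shape of a generated entry: an orbit image of a representative (with its multiplicity), or the all-zero junk entry. -/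
theorem genCell_shape (reps : List (MCell × ℤ)) (c : ℕ) :
    (∃ Rm ∈ reps, ∃ σ : Equiv.Perm (Fin 4), (genCell reps c).1 = deltaIter (c % 4) (Rm.1.perm σ) ∧ (genCell reps c).2 = Rm.2) ∨
      (genCell reps c).2 = 0 := by
  unfold genCell
  cases h1 : reps[c / 96]? with
  | none => right; rfl
  | some Rm =>
    cases h2 : permList[c % 96 / 4]? with
    | none => right; rfl
    | some σ =>
      left
      obtain ⟨R, m⟩ := Rm
      exact ⟨(R, m), List.mem_of_getElem? h1, σ, rfl, rfl⟩

/-- ORBIT COVER: every generated entry with non-zero multiplicity is `Δ^j (R ∘ σ)` for a representative `R`. -/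
theorem genList_cover (reps : List (MCell × ℤ)) (cs : List ℕ) (p : MCell × ℤ) (hp : p ∈ genList reps cs) (hm : p.2 ≠ 0) :
    ∃ Rm ∈ reps, ∃ σ : Equiv.Perm (Fin 4), ∃ j : ℕ, p.1 = deltaIter j (Rm.1.perm σ) := by
  rw [genList_eq] at hp
  obtain ⟨c, -, rfl⟩ := List.mem_map.1 hp
  rcases genCell_shape reps c with ⟨Rm, hR, σ, h1, -⟩ | h0
  · exact ⟨Rm, hR, σ, c % 4, h1⟩
  · exact absurd h0 hm

/-- the dual-world entry of an entry. -/
def dualE (p : MCell × ℤ) : MCell × ℤ := (dualCell 0 p.1, p.2)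

theorem map_dualE_fst (L : List (MCell × ℤ)) : (L.map dualE).map Prod.fst = (L.map Prod.fst).map (dualCell 0) := by
  simp only [List.map_map]; rfl

theorem nodup_dualE {L : List (MCell × ℤ)} (hL : (L.map Prod.fst).Nodup) : ((L.map dualE).map Prod.fst).Nodup := by
  rw [map_dualE_fst]; exact hL.map (dualCell_injective 0)

/-- the image of a level under the dual map is the level of the dual entries (no re-deduplication). -/
theorem image_levelOf_dual (L : List (MCell × ℤ)) (hL : (L.map Prod.fst).Nodup) :
    (levelOf L hL).image (dualCell 0) = levelOf (L.map dualE) (nodup_dualE hL) := by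
  apply Finset.val_inj.mp
  have hnd : (Multiset.map (dualCell 0) (↑(L.map Prod.fst) : Multiset MCell)).Nodup := by
    rw [Multiset.map_coe, Multiset.coe_nodup]; exact hL.map (dualCell_injective 0)
  simp only [Finset.image_val, levelOf]
  rw [Multiset.dedup_eq_self.2 hnd, Multiset.map_coe, map_dualE_fst]

namespace DesignCert

variable {LN LP : List (MCell × ℤ)} {tN tP : CT}

/-- the LITERAL dual-0 world of the certified design: levels `dual(P)`, `dual(N)` as mapped lists. -/
def cfgd (h : DesignCert LN LP tN tP) : MConfig := cfgOf (LP.map dualE) (LN.map dualE) (nodup_dualE h.nodupP) (nodup_dualE h.nodupN)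

/-- the dual-0 world of the design IS the literal one. -/
theorem dual_eq (h : DesignCert LN LP tN tP) : h.cfg.dual 0 = h.cfgd := by
  show MConfig.mk _ _ = MConfig.mk _ _
  rw [cfg_upper, cfg_lower, image_levelOf_dual, image_levelOf_dual]

theorem g1c (h : DesignCert LN LP tN tP) : G1C h.cfg := h.g1

theorem g1c_dual (h : DesignCert LN LP tN tP) : G1C h.cfgd := by rw [← h.dual_eq]; exact g1C_dual h.g1

/-- every `N`-cell is an orbit image of an `N`-representative (when the `N`-list is generated from `repsN`). -/
theorem coverN (h : DesignCert LN LP tN tP) {repsN : List (MCell × ℤ)} {csN : List ℕ} (hLN : LN = genList repsN csN)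
    {Z : MCell} (hZ : Z ∈ h.cfg.lower) : ∃ Rm ∈ repsN, ∃ σ : Equiv.Perm (Fin 4), ∃ j : ℕ, Z = deltaIter j (Rm.1.perm σ) := by
  obtain ⟨p, hp, rfl⟩ := List.mem_map.1 (h.mem_lower.1 hZ)
  have hm : p.2 ≠ 0 := (h.certN.pos p hp).ne'
  rw [hLN] at hp
  exact genList_cover repsN csN p hp hm

/-- every `P`-cell is an orbit image of a `P`-representative. -/
theorem coverP (h : DesignCert LN LP tN tP) {repsP : List (MCell × ℤ)} {csP : List ℕ} (hLP : LP = genList repsP csP)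
    {P : MCell} (hP : P ∈ h.cfg.upper) : ∃ Rm ∈ repsP, ∃ σ : Equiv.Perm (Fin 4), ∃ j : ℕ, P = deltaIter j (Rm.1.perm σ) := by
  obtain ⟨p, hp, rfl⟩ := List.mem_map.1 (h.mem_upper.1 hP)
  have hm : p.2 ≠ 0 := (h.certP.pos p hp).ne'
  rw [hLP] at hp
  exact genList_cover repsP csP p hp hm

theorem mem_cfgd_lower (h : DesignCert LN LP tN tP) {Z : MCell} : Z ∈ h.cfgd.lower ↔ ∃ P ∈ h.cfg.upper, Z = dualCell 0 P := by
  show Z ∈ (LP.map dualE).map Prod.fst ↔ _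
  rw [map_dualE_fst, List.mem_map]
  exact ⟨fun ⟨P, hP, e⟩ => ⟨P, h.mem_upper.2 hP, e.symm⟩, fun ⟨P, hP, e⟩ => ⟨P, h.mem_upper.1 hP, e.symm⟩⟩

/-- **RULE D (μ₄, M) CLOSED from the representatives.** -/
theorem ruleDMu4Closed_of_reps (h : DesignCert LN LP tN tP) {repsN repsP : List (MCell × ℤ)} {csN csP : List ℕ}
    (hLN : LN = genList repsN csN) (hLP : LP = genList repsP csP)
    (hN : ∀ R ∈ repsN, RuleDMu4N h.cfg R.1) (hP : ∀ R ∈ repsP, RuleDMu4P h.cfg R.1) : RuleDMu4Closed h.cfg := by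
  refine ⟨fun Z hZ => ?_, fun P hP' => ?_⟩
  · obtain ⟨Rm, hR, σ, j, rfl⟩ := h.coverN hLN hZ
    exact ruleDMu4N_orbit h.cfg h.g1c Rm.1 (hN Rm hR) σ j
  · obtain ⟨Rm, hR, σ, j, rfl⟩ := h.coverP hLP hP'
    exact ruleDMu4P_orbit h.cfg h.g1c Rm.1 (hP Rm hR) σ j

/-- RULE D at EVERY `N`-cell from the `N`-representatives (one level). -/
theorem ruleDN_of_reps (h : DesignCert LN LP tN tP) {repsN : List (MCell × ℤ)} {csN : List ℕ} (hLN : LN = genList repsN csN)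
    (hN : ∀ R ∈ repsN, RuleDMu4N h.cfg R.1) : ∀ Z ∈ h.cfg.lower, RuleDMu4N h.cfg Z := fun Z hZ => by
  obtain ⟨Rm, hR, σ, j, rfl⟩ := h.coverN hLN hZ
  exact ruleDMu4N_orbit h.cfg h.g1c Rm.1 (hN Rm hR) σ j

/-- RULE D at EVERY `P`-cell from the `P`-representatives (one level). -/
theorem ruleDP_of_reps (h : DesignCert LN LP tN tP) {repsP : List (MCell × ℤ)} {csP : List ℕ} (hLP : LP = genList repsP csP)
    (hP : ∀ R ∈ repsP, RuleDMu4P h.cfg R.1) : ∀ P ∈ h.cfg.upper, RuleDMu4P h.cfg P := fun P hP' => by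
  obtain ⟨Rm, hR, σ, j, rfl⟩ := h.coverP hLP hP'
  exact ruleDMu4P_orbit h.cfg h.g1c Rm.1 (hP Rm hR) σ j

/-- **X⁺ CLOSED from the guarded X-heads at the duals of the `P`-representatives (in the literal dual world).** -/
theorem xPlusClosed_of_reps (h : DesignCert LN LP tN tP) {repsP : List (MCell × ℤ)} {csP : List ℕ} (hLP : LP = genList repsP csP)
    (hX : ∀ R ∈ repsP, XHeadG h.cfgd (dualCell 0 R.1)) : XPlusClosed h.cfg := by
  show XresXClosed (h.cfg.dual 0)
  rw [h.dual_eq]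
  refine xresXClosed_of_heads fun Z hZ => ?_
  obtain ⟨P, hP, rfl⟩ := h.mem_cfgd_lower.1 hZ
  obtain ⟨Rm, hR, σ, j, rfl⟩ := h.coverP hLP hP
  rw [dualCell_deltaIter_perm]
  exact xHead_orbit h.cfgd h.g1c_dual _ (xHead_of_guarded (hX Rm hR)) σ j

/-- **X⁻ CLOSED from the guarded X-heads at the `N`-representatives.** -/
theorem xMinusClosed_of_reps (h : DesignCert LN LP tN tP) {repsN : List (MCell × ℤ)} {csN : List ℕ} (hLN : LN = genList repsN csN)
    (hX : ∀ R ∈ repsN, XHeadG h.cfg R.1) : XMinusClosed h.cfg := by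
  refine xresXClosed_of_heads fun Z hZ => ?_
  obtain ⟨Rm, hR, σ, j, rfl⟩ := h.coverN hLN hZ
  exact xHead_orbit h.cfg h.g1c _ (xHead_of_guarded (hX Rm hR)) σ j

/-- **A2I⁻ CLOSED from the guarded A2I-heads at the `N`-representatives.** -/
theorem a2iMinusClosed_of_reps (h : DesignCert LN LP tN tP) {repsN : List (MCell × ℤ)} {csN : List ℕ} (hLN : LN = genList repsN csN)
    (hA : ∀ R ∈ repsN, AHeadG h.cfg R.1) : A2IMinusClosed h.cfg := by
  refine xresA2IClosed_of_heads fun Z hZ => ?_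
  obtain ⟨Rm, hR, σ, j, rfl⟩ := h.coverN hLN hZ
  exact aHead_orbit h.cfg h.g1c _ (aHead_of_guarded (hA Rm hR)) σ j

/-- **A2I⁺ CLOSED from the guarded A2I-heads at the duals of the `P`-representatives.** -/
theorem a2iPlusClosed_of_reps (h : DesignCert LN LP tN tP) {repsP : List (MCell × ℤ)} {csP : List ℕ} (hLP : LP = genList repsP csP)
    (hA : ∀ R ∈ repsP, AHeadG h.cfgd (dualCell 0 R.1)) : A2IPlusClosed h.cfg := by
  show XresA2IClosed (h.cfg.dual 0)
  rw [h.dual_eq]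
  refine xresA2IClosed_of_heads fun Z hZ => ?_
  obtain ⟨P, hP, rfl⟩ := h.mem_cfgd_lower.1 hZ
  obtain ⟨Rm, hR, σ, j, rfl⟩ := h.coverP hLP hP
  rw [dualCell_deltaIter_perm]
  exact aHead_orbit h.cfgd h.g1c_dual _ (aHead_of_guarded (hA Rm hR)) σ j

end DesignCert

/-! ### §0.9 One-pass evaluators for the 22 + 1 representative words (all words in one sweep over the cells; CSE'd integer straight-line code) -/

/-- negate the multiplicities (the `P`-level enters the class tensor with a minus sign). -/
def negM (L : List (MCell × ℤ)) : List (MCell × ℤ) := L.map fun p => (p.1, -p.2)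

/-- the real part of a word's list sum, as an integer list sum over the raw cell values. -/
def reSum (w : CWord) (L : List (MCell × ℤ)) : ℤ := (L.map fun p => p.2 * (chRaw p.1 w).1).sum
/-- the imaginary part of a word's list sum, as an integer list sum over the raw cell values. -/
def imSum (w : CWord) (L : List (MCell × ℤ)) : ℤ := (L.map fun p => p.2 * (chRaw p.1 w).2).sum

theorem re_listSum (w : CWord) (L : List (MCell × ℤ)) : (listSum w L).re = reSum w L := by
  induction L with
  | nil => simp [listSum, reSum]
  | cons p L ih =>
    simp only [listSum, reSum, List.map_cons, List.sum_cons, Zsqrtd.re_add, Zsqrtd.re_smul] at ih ⊢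
    rw [ih, ← toG_chRaw]; rfl

theorem im_listSum (w : CWord) (L : List (MCell × ℤ)) : (listSum w L).im = imSum w L := by
  induction L with
  | nil => simp [listSum, imSum]
  | cons p L ih =>
    simp only [listSum, imSum, List.map_cons, List.sum_cons, Zsqrtd.im_add, Zsqrtd.im_smul] at ih ⊢
    rw [ih, ← toG_chRaw]; rfl

theorem reSum_append (w : CWord) (L₁ L₂ : List (MCell × ℤ)) : reSum w (L₁ ++ L₂) = reSum w L₁ + reSum w L₂ := by
  simp [reSum, List.map_append, List.sum_append]

theorem imSum_append (w : CWord) (L₁ L₂ : List (MCell × ℤ)) : imSum w (L₁ ++ L₂) = imSum w L₁ + imSum w L₂ := by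
  simp [imSum, List.map_append, List.sum_append]

theorem reSum_negM (w : CWord) (L : List (MCell × ℤ)) : reSum w (negM L) = -reSum w L := by
  induction L with
  | nil => simp [reSum, negM]
  | cons p L ih =>
    simp only [reSum, negM, List.map_cons, List.sum_cons] at ih ⊢
    rw [ih]; ring

theorem imSum_negM (w : CWord) (L : List (MCell × ℤ)) : imSum w (negM L) = -imSum w L := by
  induction L with
  | nil => simp [imSum, negM]
  | cons p L ih =>
    simp only [imSum, negM, List.map_cons, List.sum_cons] at ih ⊢
    rw [ih]; ring

theorem reSum_append_negM (w : CWord) (LN LP : List (MCell × ℤ)) : reSum w (LN ++ negM LP) = reSum w LN - reSum w LP := by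
  rw [reSum_append, reSum_negM, sub_eq_add_neg]

theorem imSum_append_negM (w : CWord) (LN LP : List (MCell × ℤ)) : imSum w (LN ++ negM LP) = imSum w LN - imSum w LP := by
  rw [imSum_append, imSum_negM, sub_eq_add_neg]

/-- the difference of the list sums, componentwise, from the one-pass sums over `LN ++ negM LP`. -/
theorem listSum_sub_eq (w : CWord) (LN LP : List (MCell × ℤ)) (a b : ℤ) (ha : reSum w (LN ++ negM LP) = a)
    (hb : imSum w (LN ++ negM LP) = b) : listSum w LN - listSum w LP = ⟨a, b⟩ := by
  ext
  · rw [Zsqrtd.re_sub, re_listSum, re_listSum, ← reSum_append_negM, ha]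
  · rw [Zsqrtd.im_sub, im_listSum, im_listSum, ← imSum_append_negM, hb]

/-! ### group A: the 15 e-free representatives (real; products of `α_f` and `p_f = α_f² − |β_f|²`) -/

section PolyA
variable (Z : MCell)
theorem chA_1 : chRaw Z ![0, 0, 0, 0] = (1, 0) := by
  ext <;> simp [chRaw, gmul, letv, -mul_eq_mul_left_iff, -mul_eq_mul_right_iff]
theorem chA_2 : chRaw Z ![1, 0, 0, 0] = ((Z 0).1, 0) := by
  ext <;> simp [chRaw, gmul, letv, -mul_eq_mul_left_iff, -mul_eq_mul_right_iff]
theorem chA_3 : chRaw Z ![1, 1, 0, 0] = ((Z 0).1 * (Z 1).1, 0) := by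
  ext <;> simp [chRaw, gmul, letv, -mul_eq_mul_left_iff, -mul_eq_mul_right_iff]
theorem chA_4 : chRaw Z ![1, 1, 1, 0] = ((Z 0).1 * (Z 1).1 * (Z 2).1, 0) := by
  ext <;> simp [chRaw, gmul, letv, -mul_eq_mul_left_iff, -mul_eq_mul_right_iff]
theorem chA_5 : chRaw Z ![1, 1, 1, 1] = ((Z 0).1 * (Z 1).1 * (Z 2).1 * (Z 3).1, 0) := by
  ext <;> simp [chRaw, gmul, letv, -mul_eq_mul_left_iff, -mul_eq_mul_right_iff]
theorem chA_6 : chRaw Z ![5, 0, 0, 0] = ((Z 0).1 * (Z 0).1 - (Z 0).2.1 * (Z 0).2.1 - (Z 0).2.2 * (Z 0).2.2, 0) := by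
  ext <;> simp [chRaw, gmul, letv, -mul_eq_mul_left_iff, -mul_eq_mul_right_iff]
theorem chA_7 : chRaw Z ![5, 1, 0, 0] = (((Z 0).1 * (Z 0).1 - (Z 0).2.1 * (Z 0).2.1 - (Z 0).2.2 * (Z 0).2.2) * (Z 1).1, 0) := by
  ext <;> simp [chRaw, gmul, letv, -mul_eq_mul_left_iff, -mul_eq_mul_right_iff]
theorem chA_8 : chRaw Z ![5, 1, 1, 0] = (((Z 0).1 * (Z 0).1 - (Z 0).2.1 * (Z 0).2.1 - (Z 0).2.2 * (Z 0).2.2) * (Z 1).1 * (Z 2).1, 0) := by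
  ext <;> simp [chRaw, gmul, letv, -mul_eq_mul_left_iff, -mul_eq_mul_right_iff]
theorem chA_9 : chRaw Z ![5, 1, 1, 1] =
    (((Z 0).1 * (Z 0).1 - (Z 0).2.1 * (Z 0).2.1 - (Z 0).2.2 * (Z 0).2.2) * (Z 1).1 * (Z 2).1 * (Z 3).1, 0) := by
  ext <;> simp [chRaw, gmul, letv, -mul_eq_mul_left_iff, -mul_eq_mul_right_iff]
theorem chA_10 : chRaw Z ![5, 5, 0, 0] = (((Z 0).1 * (Z 0).1 - (Z 0).2.1 * (Z 0).2.1 - (Z 0).2.2 * (Z 0).2.2) *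
    ((Z 1).1 * (Z 1).1 - (Z 1).2.1 * (Z 1).2.1 - (Z 1).2.2 * (Z 1).2.2), 0) := by
  ext <;> simp [chRaw, gmul, letv, -mul_eq_mul_left_iff, -mul_eq_mul_right_iff]
theorem chA_11 : chRaw Z ![5, 5, 1, 0] = (((Z 0).1 * (Z 0).1 - (Z 0).2.1 * (Z 0).2.1 - (Z 0).2.2 * (Z 0).2.2) *
    ((Z 1).1 * (Z 1).1 - (Z 1).2.1 * (Z 1).2.1 - (Z 1).2.2 * (Z 1).2.2) * (Z 2).1, 0) := by
  ext <;> simp [chRaw, gmul, letv, -mul_eq_mul_left_iff, -mul_eq_mul_right_iff]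
theorem chA_12 : chRaw Z ![5, 5, 1, 1] = (((Z 0).1 * (Z 0).1 - (Z 0).2.1 * (Z 0).2.1 - (Z 0).2.2 * (Z 0).2.2) *
    ((Z 1).1 * (Z 1).1 - (Z 1).2.1 * (Z 1).2.1 - (Z 1).2.2 * (Z 1).2.2) * (Z 2).1 * (Z 3).1, 0) := by
  ext <;> simp [chRaw, gmul, letv, -mul_eq_mul_left_iff, -mul_eq_mul_right_iff]
theorem chA_13 : chRaw Z ![5, 5, 5, 0] = (((Z 0).1 * (Z 0).1 - (Z 0).2.1 * (Z 0).2.1 - (Z 0).2.2 * (Z 0).2.2) *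
    ((Z 1).1 * (Z 1).1 - (Z 1).2.1 * (Z 1).2.1 - (Z 1).2.2 * (Z 1).2.2) *
    ((Z 2).1 * (Z 2).1 - (Z 2).2.1 * (Z 2).2.1 - (Z 2).2.2 * (Z 2).2.2), 0) := by
  ext <;> simp [chRaw, gmul, letv, -mul_eq_mul_left_iff, -mul_eq_mul_right_iff]
theorem chA_14 : chRaw Z ![5, 5, 5, 1] = (((Z 0).1 * (Z 0).1 - (Z 0).2.1 * (Z 0).2.1 - (Z 0).2.2 * (Z 0).2.2) *
    ((Z 1).1 * (Z 1).1 - (Z 1).2.1 * (Z 1).2.1 - (Z 1).2.2 * (Z 1).2.2) *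
    ((Z 2).1 * (Z 2).1 - (Z 2).2.1 * (Z 2).2.1 - (Z 2).2.2 * (Z 2).2.2) * (Z 3).1, 0) := by
  ext <;> simp [chRaw, gmul, letv, -mul_eq_mul_left_iff, -mul_eq_mul_right_iff]
theorem chA_15 : chRaw Z ![5, 5, 5, 5] = (((Z 0).1 * (Z 0).1 - (Z 0).2.1 * (Z 0).2.1 - (Z 0).2.2 * (Z 0).2.2) *
    ((Z 1).1 * (Z 1).1 - (Z 1).2.1 * (Z 1).2.1 - (Z 1).2.2 * (Z 1).2.2) *
    ((Z 2).1 * (Z 2).1 - (Z 2).2.1 * (Z 2).2.1 - (Z 2).2.2 * (Z 2).2.2) *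
    ((Z 3).1 * (Z 3).1 - (Z 3).2.1 * (Z 3).2.1 - (Z 3).2.2 * (Z 3).2.2), 0) := by
  ext <;> simp [chRaw, gmul, letv, -mul_eq_mul_left_iff, -mul_eq_mul_right_iff]
end PolyA

/-- the 15 e-free representative values of ONE cell (in the order of `freeReps`), computed with shared sub-products, every
intermediate forced, passed on to `k`. -/
def monoA {α : Type} (Z : MCell) (k : ℤ → ℤ → ℤ → ℤ → ℤ → ℤ → ℤ → ℤ → ℤ → ℤ → ℤ → ℤ → ℤ → ℤ → ℤ → α) : α :=
  forceInt (Z 0).1 fun a0 => forceInt (Z 0).2.1 fun r0 => forceInt (Z 0).2.2 fun i0 =>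
  forceInt (Z 1).1 fun a1 => forceInt (Z 1).2.1 fun r1 => forceInt (Z 1).2.2 fun i1 =>
  forceInt (Z 2).1 fun a2 => forceInt (Z 2).2.1 fun r2 => forceInt (Z 2).2.2 fun i2 =>
  forceInt (Z 3).1 fun a3 => forceInt (Z 3).2.1 fun r3 => forceInt (Z 3).2.2 fun i3 =>
  forceInt (a0 * a0 - r0 * r0 - i0 * i0) fun p0 => forceInt (a1 * a1 - r1 * r1 - i1 * i1) fun p1 =>
  forceInt (a2 * a2 - r2 * r2 - i2 * i2) fun p2 => forceInt (a3 * a3 - r3 * r3 - i3 * i3) fun p3 =>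
  forceInt (a0 * a1) fun t1 => forceInt (t1 * a2) fun t2 => forceInt (t2 * a3) fun t3 =>
  forceInt (p0 * a1) fun t4 => forceInt (t4 * a2) fun t5 => forceInt (t5 * a3) fun t6 =>
  forceInt (p0 * p1) fun t7 => forceInt (t7 * a2) fun t8 => forceInt (t8 * a3) fun t9 =>
  forceInt (t7 * p2) fun t10 => forceInt (t10 * a3) fun t11 => forceInt (t10 * p3) fun t12 =>
  k 1 a0 t1 t2 t3 p0 t4 t5 t6 t7 t8 t9 t10 t11 t12

/-- `monoA` computes the real parts of the raw cell values at the 15 free representatives. -/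
theorem monoA_eq {α : Type} (Z : MCell) (k : ℤ → ℤ → ℤ → ℤ → ℤ → ℤ → ℤ → ℤ → ℤ → ℤ → ℤ → ℤ → ℤ → ℤ → ℤ → α) :
    monoA Z k = k (chRaw Z ![0, 0, 0, 0]).1 (chRaw Z ![1, 0, 0, 0]).1 (chRaw Z ![1, 1, 0, 0]).1 (chRaw Z ![1, 1, 1, 0]).1
      (chRaw Z ![1, 1, 1, 1]).1 (chRaw Z ![5, 0, 0, 0]).1 (chRaw Z ![5, 1, 0, 0]).1 (chRaw Z ![5, 1, 1, 0]).1 (chRaw Z ![5, 1, 1, 1]).1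
      (chRaw Z ![5, 5, 0, 0]).1 (chRaw Z ![5, 5, 1, 0]).1 (chRaw Z ![5, 5, 1, 1]).1 (chRaw Z ![5, 5, 5, 0]).1 (chRaw Z ![5, 5, 5, 1]).1
      (chRaw Z ![5, 5, 5, 5]).1 := by
  simp only [monoA, forceInt_eq, chA_1, chA_2, chA_3, chA_4, chA_5, chA_6, chA_7, chA_8, chA_9, chA_10, chA_11, chA_12, chA_13,
    chA_14, chA_15]

/-- ONE-PASS accumulator of the 15 free representative sums. -/
def sumA : List (MCell × ℤ) → ℤ → ℤ → ℤ → ℤ → ℤ → ℤ → ℤ → ℤ → ℤ → ℤ → ℤ → ℤ → ℤ → ℤ → ℤ → List ℤ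
  | [], s1, s2, s3, s4, s5, s6, s7, s8, s9, s10, s11, s12, s13, s14, s15 => [s1, s2, s3, s4, s5, s6, s7, s8, s9, s10, s11, s12, s13, s14, s15]
  | (Z, m) :: L, s1, s2, s3, s4, s5, s6, s7, s8, s9, s10, s11, s12, s13, s14, s15 =>
    monoA Z fun v1 v2 v3 v4 v5 v6 v7 v8 v9 v10 v11 v12 v13 v14 v15 =>
      forceInt (s1 + m * v1) fun s1 => forceInt (s2 + m * v2) fun s2 => forceInt (s3 + m * v3) fun s3 =>
      forceInt (s4 + m * v4) fun s4 => forceInt (s5 + m * v5) fun s5 => forceInt (s6 + m * v6) fun s6 =>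
      forceInt (s7 + m * v7) fun s7 => forceInt (s8 + m * v8) fun s8 => forceInt (s9 + m * v9) fun s9 =>
      forceInt (s10 + m * v10) fun s10 => forceInt (s11 + m * v11) fun s11 => forceInt (s12 + m * v12) fun s12 =>
      forceInt (s13 + m * v13) fun s13 => forceInt (s14 + m * v14) fun s14 => forceInt (s15 + m * v15) fun s15 =>
      sumA L s1 s2 s3 s4 s5 s6 s7 s8 s9 s10 s11 s12 s13 s14 s15

/-- `sumA` accumulates the 15 real sums `reSum`. -/
theorem sumA_eq (L : List (MCell × ℤ)) (s1 s2 s3 s4 s5 s6 s7 s8 s9 s10 s11 s12 s13 s14 s15 : ℤ) :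
    sumA L s1 s2 s3 s4 s5 s6 s7 s8 s9 s10 s11 s12 s13 s14 s15 =
      [s1 + reSum ![0, 0, 0, 0] L, s2 + reSum ![1, 0, 0, 0] L, s3 + reSum ![1, 1, 0, 0] L, s4 + reSum ![1, 1, 1, 0] L,
       s5 + reSum ![1, 1, 1, 1] L, s6 + reSum ![5, 0, 0, 0] L, s7 + reSum ![5, 1, 0, 0] L, s8 + reSum ![5, 1, 1, 0] L,
       s9 + reSum ![5, 1, 1, 1] L, s10 + reSum ![5, 5, 0, 0] L, s11 + reSum ![5, 5, 1, 0] L, s12 + reSum ![5, 5, 1, 1] L,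
       s13 + reSum ![5, 5, 5, 0] L, s14 + reSum ![5, 5, 5, 1] L, s15 + reSum ![5, 5, 5, 5] L] := by
  induction L generalizing s1 s2 s3 s4 s5 s6 s7 s8 s9 s10 s11 s12 s13 s14 s15 with
  | nil => simp [sumA, reSum]
  | cons p L ih =>
    obtain ⟨Z, m⟩ := p
    simp only [sumA, monoA_eq, forceInt_eq, ih, reSum, List.map_cons, List.sum_cons, add_assoc]

/-! ### group B: the 7 mixed representatives and `eeee` (complex; shared sub-products `e₀ē₁`, `e₀e₁`, `e₂e₃`) -/

section PolyB
variable (Z : MCell)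
theorem chB_1 : chRaw Z ![3, 4, 0, 0] =
    ((Z 0).2.1 * (Z 1).2.1 + (Z 0).2.2 * (Z 1).2.2, (Z 0).2.2 * (Z 1).2.1 - (Z 0).2.1 * (Z 1).2.2) := by
  ext <;> simp [chRaw, gmul, letv, -mul_eq_mul_left_iff, -mul_eq_mul_right_iff] <;> ring
theorem chB_2 : chRaw Z ![3, 4, 0, 1] =
    (((Z 0).2.1 * (Z 1).2.1 + (Z 0).2.2 * (Z 1).2.2) * (Z 3).1, ((Z 0).2.2 * (Z 1).2.1 - (Z 0).2.1 * (Z 1).2.2) * (Z 3).1) := by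
  ext <;> simp [chRaw, gmul, letv, -mul_eq_mul_left_iff, -mul_eq_mul_right_iff] <;> ring
theorem chB_3 : chRaw Z ![3, 4, 0, 5] =
    (((Z 0).2.1 * (Z 1).2.1 + (Z 0).2.2 * (Z 1).2.2) * ((Z 3).1 * (Z 3).1 - (Z 3).2.1 * (Z 3).2.1 - (Z 3).2.2 * (Z 3).2.2),
     ((Z 0).2.2 * (Z 1).2.1 - (Z 0).2.1 * (Z 1).2.2) * ((Z 3).1 * (Z 3).1 - (Z 3).2.1 * (Z 3).2.1 - (Z 3).2.2 * (Z 3).2.2)) := by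
  ext <;> simp [chRaw, gmul, letv, -mul_eq_mul_left_iff, -mul_eq_mul_right_iff] <;> ring
theorem chB_4 : chRaw Z ![3, 4, 1, 1] =
    (((Z 0).2.1 * (Z 1).2.1 + (Z 0).2.2 * (Z 1).2.2) * ((Z 2).1 * (Z 3).1), ((Z 0).2.2 * (Z 1).2.1 - (Z 0).2.1 * (Z 1).2.2) * ((Z 2).1 * (Z 3).1)) := by
  ext <;> simp [chRaw, gmul, letv, -mul_eq_mul_left_iff, -mul_eq_mul_right_iff] <;> ring
theorem chB_5 : chRaw Z ![3, 4, 1, 5] =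
    (((Z 0).2.1 * (Z 1).2.1 + (Z 0).2.2 * (Z 1).2.2) * ((Z 2).1 * ((Z 3).1 * (Z 3).1 - (Z 3).2.1 * (Z 3).2.1 - (Z 3).2.2 * (Z 3).2.2)),
     ((Z 0).2.2 * (Z 1).2.1 - (Z 0).2.1 * (Z 1).2.2) * ((Z 2).1 * ((Z 3).1 * (Z 3).1 - (Z 3).2.1 * (Z 3).2.1 - (Z 3).2.2 * (Z 3).2.2))) := by
  ext <;> simp [chRaw, gmul, letv, -mul_eq_mul_left_iff, -mul_eq_mul_right_iff] <;> ring
theorem chB_6 : chRaw Z ![3, 4, 5, 5] =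
    (((Z 0).2.1 * (Z 1).2.1 + (Z 0).2.2 * (Z 1).2.2) *
      (((Z 2).1 * (Z 2).1 - (Z 2).2.1 * (Z 2).2.1 - (Z 2).2.2 * (Z 2).2.2) * ((Z 3).1 * (Z 3).1 - (Z 3).2.1 * (Z 3).2.1 - (Z 3).2.2 * (Z 3).2.2)),
     ((Z 0).2.2 * (Z 1).2.1 - (Z 0).2.1 * (Z 1).2.2) *
      (((Z 2).1 * (Z 2).1 - (Z 2).2.1 * (Z 2).2.1 - (Z 2).2.2 * (Z 2).2.2) * ((Z 3).1 * (Z 3).1 - (Z 3).2.1 * (Z 3).2.1 - (Z 3).2.2 * (Z 3).2.2))) := by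
  ext <;> simp [chRaw, gmul, letv, -mul_eq_mul_left_iff, -mul_eq_mul_right_iff] <;> ring
theorem chB_7 : chRaw Z ![3, 3, 4, 4] =
    (((Z 0).2.1 * (Z 1).2.1 - (Z 0).2.2 * (Z 1).2.2) * ((Z 2).2.1 * (Z 3).2.1 - (Z 2).2.2 * (Z 3).2.2) +
        ((Z 0).2.1 * (Z 1).2.2 + (Z 0).2.2 * (Z 1).2.1) * ((Z 2).2.1 * (Z 3).2.2 + (Z 2).2.2 * (Z 3).2.1),
     ((Z 0).2.1 * (Z 1).2.2 + (Z 0).2.2 * (Z 1).2.1) * ((Z 2).2.1 * (Z 3).2.1 - (Z 2).2.2 * (Z 3).2.2) -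
        ((Z 0).2.1 * (Z 1).2.1 - (Z 0).2.2 * (Z 1).2.2) * ((Z 2).2.1 * (Z 3).2.2 + (Z 2).2.2 * (Z 3).2.1)) := by
  ext <;> simp [chRaw, gmul, letv, -mul_eq_mul_left_iff, -mul_eq_mul_right_iff] <;> ring
theorem chB_8 : chRaw Z eWord =
    (((Z 0).2.1 * (Z 1).2.1 - (Z 0).2.2 * (Z 1).2.2) * ((Z 2).2.1 * (Z 3).2.1 - (Z 2).2.2 * (Z 3).2.2) -
        ((Z 0).2.1 * (Z 1).2.2 + (Z 0).2.2 * (Z 1).2.1) * ((Z 2).2.1 * (Z 3).2.2 + (Z 2).2.2 * (Z 3).2.1),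
     ((Z 0).2.1 * (Z 1).2.1 - (Z 0).2.2 * (Z 1).2.2) * ((Z 2).2.1 * (Z 3).2.2 + (Z 2).2.2 * (Z 3).2.1) +
        ((Z 0).2.1 * (Z 1).2.2 + (Z 0).2.2 * (Z 1).2.1) * ((Z 2).2.1 * (Z 3).2.1 - (Z 2).2.2 * (Z 3).2.2)) := by
  ext <;> simp [chRaw, gmul, letv, eWord, -mul_eq_mul_left_iff, -mul_eq_mul_right_iff] <;> ring
end PolyB

/-- the 8 complex representative values (7 mixed + `eeee`, as 16 integers re∕im in the order of `mixedReps`, then `eeee`) of ONE cell,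
shared sub-products, every intermediate forced, passed on to `k`. -/
def monoB {α : Type} (Z : MCell) (k : ℤ → ℤ → ℤ → ℤ → ℤ → ℤ → ℤ → ℤ → ℤ → ℤ → ℤ → ℤ → ℤ → ℤ → ℤ → ℤ → α) : α :=
  forceInt (Z 0).2.1 fun r0 => forceInt (Z 0).2.2 fun i0 => forceInt (Z 1).2.1 fun r1 => forceInt (Z 1).2.2 fun i1 =>
  forceInt (Z 2).1 fun a2 => forceInt (Z 2).2.1 fun r2 => forceInt (Z 2).2.2 fun i2 =>
  forceInt (Z 3).1 fun a3 => forceInt (Z 3).2.1 fun r3 => forceInt (Z 3).2.2 fun i3 =>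
  forceInt (a2 * a2 - r2 * r2 - i2 * i2) fun p2 => forceInt (a3 * a3 - r3 * r3 - i3 * i3) fun p3 =>
  forceInt (r0 * r1 + i0 * i1) fun bre => forceInt (i0 * r1 - r0 * i1) fun bim =>
  forceInt (a2 * a3) fun t1 => forceInt (a2 * p3) fun t2 => forceInt (p2 * p3) fun t3 =>
  forceInt (r0 * r1 - i0 * i1) fun cre => forceInt (r0 * i1 + i0 * r1) fun cim =>
  forceInt (r2 * r3 - i2 * i3) fun ere => forceInt (r2 * i3 + i2 * r3) fun eim =>
  k bre bim (bre * a3) (bim * a3) (bre * p3) (bim * p3) (bre * t1) (bim * t1) (bre * t2) (bim * t2) (bre * t3) (bim * t3)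
    (cre * ere + cim * eim) (cim * ere - cre * eim) (cre * ere - cim * eim) (cre * eim + cim * ere)

/-- `monoB` computes the raw cell values at the 7 mixed representatives and at `eeee`. -/
theorem monoB_eq {α : Type} (Z : MCell) (k : ℤ → ℤ → ℤ → ℤ → ℤ → ℤ → ℤ → ℤ → ℤ → ℤ → ℤ → ℤ → ℤ → ℤ → ℤ → ℤ → α) :
    monoB Z k = k (chRaw Z ![3, 4, 0, 0]).1 (chRaw Z ![3, 4, 0, 0]).2 (chRaw Z ![3, 4, 0, 1]).1 (chRaw Z ![3, 4, 0, 1]).2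
      (chRaw Z ![3, 4, 0, 5]).1 (chRaw Z ![3, 4, 0, 5]).2 (chRaw Z ![3, 4, 1, 1]).1 (chRaw Z ![3, 4, 1, 1]).2
      (chRaw Z ![3, 4, 1, 5]).1 (chRaw Z ![3, 4, 1, 5]).2 (chRaw Z ![3, 4, 5, 5]).1 (chRaw Z ![3, 4, 5, 5]).2
      (chRaw Z ![3, 3, 4, 4]).1 (chRaw Z ![3, 3, 4, 4]).2 (chRaw Z eWord).1 (chRaw Z eWord).2 := by
  simp only [monoB, forceInt_eq, chB_1, chB_2, chB_3, chB_4, chB_5, chB_6, chB_7, chB_8]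

/-- ONE-PASS accumulator of the 8 complex representative sums (16 integers). -/
def sumB : List (MCell × ℤ) → ℤ → ℤ → ℤ → ℤ → ℤ → ℤ → ℤ → ℤ → ℤ → ℤ → ℤ → ℤ → ℤ → ℤ → ℤ → ℤ → List ℤ
  | [], s1, s2, s3, s4, s5, s6, s7, s8, s9, s10, s11, s12, s13, s14, s15, s16 =>
    [s1, s2, s3, s4, s5, s6, s7, s8, s9, s10, s11, s12, s13, s14, s15, s16]
  | (Z, m) :: L, s1, s2, s3, s4, s5, s6, s7, s8, s9, s10, s11, s12, s13, s14, s15, s16 =>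
    monoB Z fun v1 v2 v3 v4 v5 v6 v7 v8 v9 v10 v11 v12 v13 v14 v15 v16 =>
      forceInt (s1 + m * v1) fun s1 => forceInt (s2 + m * v2) fun s2 => forceInt (s3 + m * v3) fun s3 =>
      forceInt (s4 + m * v4) fun s4 => forceInt (s5 + m * v5) fun s5 => forceInt (s6 + m * v6) fun s6 =>
      forceInt (s7 + m * v7) fun s7 => forceInt (s8 + m * v8) fun s8 => forceInt (s9 + m * v9) fun s9 =>
      forceInt (s10 + m * v10) fun s10 => forceInt (s11 + m * v11) fun s11 => forceInt (s12 + m * v12) fun s12 =>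
      forceInt (s13 + m * v13) fun s13 => forceInt (s14 + m * v14) fun s14 => forceInt (s15 + m * v15) fun s15 =>
      forceInt (s16 + m * v16) fun s16 =>
      sumB L s1 s2 s3 s4 s5 s6 s7 s8 s9 s10 s11 s12 s13 s14 s15 s16

/-- `sumB` accumulates the 8 complex sums (`reSum`∕`imSum` pairs). -/
theorem sumB_eq (L : List (MCell × ℤ)) (s1 s2 s3 s4 s5 s6 s7 s8 s9 s10 s11 s12 s13 s14 s15 s16 : ℤ) :
    sumB L s1 s2 s3 s4 s5 s6 s7 s8 s9 s10 s11 s12 s13 s14 s15 s16 =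
      [s1 + reSum ![3, 4, 0, 0] L, s2 + imSum ![3, 4, 0, 0] L, s3 + reSum ![3, 4, 0, 1] L, s4 + imSum ![3, 4, 0, 1] L,
       s5 + reSum ![3, 4, 0, 5] L, s6 + imSum ![3, 4, 0, 5] L, s7 + reSum ![3, 4, 1, 1] L, s8 + imSum ![3, 4, 1, 1] L,
       s9 + reSum ![3, 4, 1, 5] L, s10 + imSum ![3, 4, 1, 5] L, s11 + reSum ![3, 4, 5, 5] L, s12 + imSum ![3, 4, 5, 5] L,
       s13 + reSum ![3, 3, 4, 4] L, s14 + imSum ![3, 3, 4, 4] L, s15 + reSum eWord L, s16 + imSum eWord L] := by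
  induction L generalizing s1 s2 s3 s4 s5 s6 s7 s8 s9 s10 s11 s12 s13 s14 s15 s16 with
  | nil => simp [sumB, reSum, imSum]
  | cons p L ih =>
    obtain ⟨Z, m⟩ := p
    simp only [sumB, monoB_eq, forceInt_eq, ih, reSum, imSum, List.map_cons, List.sum_cons, add_assoc]

/-- e-free letters have real raw values. -/
theorem letv_im_zero (x : BPoint) (l : Fin 6) (h3 : l ≠ 3) (h4 : l ≠ 4) : (letv x l).2 = 0 := by
  fin_cases l <;> simp_all [letv]

theorem gmul_im_zero {a b : ℤ × ℤ} (ha : a.2 = 0) (hb : b.2 = 0) : (gmul a b).2 = 0 := by simp [gmul, ha, hb]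

/-- the raw value of a cell at an e-free word is real. -/
theorem chRaw_im_zero (Z : MCell) (w : CWord) (hw : EFree w) : (chRaw Z w).2 = 0 :=
  gmul_im_zero (gmul_im_zero (gmul_im_zero (letv_im_zero _ _ (hw 0).1 (hw 0).2) (letv_im_zero _ _ (hw 1).1 (hw 1).2))
    (letv_im_zero _ _ (hw 2).1 (hw 2).2)) (letv_im_zero _ _ (hw 3).1 (hw 3).2)

theorem imSum_zero (w : CWord) (hw : EFree w) (L : List (MCell × ℤ)) : imSum w L = 0 := by
  induction L with
  | nil => simp [imSum]
  | cons p L ih => simp only [imSum, List.map_cons, List.sum_cons, chRaw_im_zero _ _ hw, mul_zero, zero_add] at ih ⊢; exact ih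

namespace DesignCert

variable {LN LP : List (MCell × ℤ)} {tN tP : CT}

/-- a word value of the certified design from the one-pass integer sums. -/
theorem wch_of_sums (h : DesignCert LN LP tN tP) (w : CWord) (a b : ℤ) (ha : reSum w (LN ++ negM LP) = a)
    (hb : imSum w (LN ++ negM LP) = b) : h.cfg.wch (mT tN) (mT tP) w = ⟨a, b⟩ := by
  rw [h.wch_eq, toG_rawT]; exact listSum_sub_eq w LN LP a b ha hb

/-- a word value at an e-free word from the real one-pass sum alone. -/
theorem wch_of_reSum (h : DesignCert LN LP tN tP) (w : CWord) (hw : EFree w) (a : ℤ) (ha : reSum w (LN ++ negM LP) = a) :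
    h.cfg.wch (mT tN) (mT tP) w = ⟨a, 0⟩ := h.wch_of_sums w a 0 ha (imSum_zero w hw _)

/-- **(A1), μ and the free values of the certified design from the two one-pass evaluations.** -/
theorem classScreen_of_sums (h : DesignCert LN LP tN tP) (q : ℕ → ℤ) (x15 x16 : ℤ)
    (hA : sumA (LN ++ negM LP) 0 0 0 0 0 0 0 0 0 0 0 0 0 0 0 =
      [q 0, q 1, q 2, q 3, q 4, q 2, q 3, q 4, q 5, q 4, q 5, q 6, q 6, q 7, q 8])
    (hB : sumB (LN ++ negM LP) 0 0 0 0 0 0 0 0 0 0 0 0 0 0 0 0 = [0, 0, 0, 0, 0, 0, 0, 0, 0, 0, 0, 0, 0, 0, x15, x16]) :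
    ClassScreen (h.cfg.wch (mT tN) (mT tP)) ∧ h.cfg.wch (mT tN) (mT tP) eWord = ⟨x15, x16⟩ := by
  rw [sumA_eq] at hA
  rw [sumB_eq] at hB
  simp only [zero_add, List.cons.injEq, and_true] at hA hB
  obtain ⟨a1, a2, a3, a4, a5, a6, a7, a8, a9, a10, a11, a12, a13, a14, a15⟩ := hA
  obtain ⟨b1, b2, b3, b4, b5, b6, b7, b8, b9, b10, b11, b12, b13, b14, b15, b16⟩ := hB
  obtain ⟨g1, g2, g3, g4⟩ := h.g1
  refine ⟨classScreen_of_reps h.cfg (mT tN) (mT tP) g1 g2 g3 g4 h.certN.pInv h.certP.pInv h.certN.dInv h.certP.dInv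
    (fun k => ⟨q k, 0⟩) (fun r hr => ?_) (fun r hr => ?_), h.wch_of_sums eWord x15 x16 b15 b16⟩
  · simp only [mixedReps, List.mem_cons, List.not_mem_nil, or_false] at hr
    rcases hr with rfl | rfl | rfl | rfl | rfl | rfl | rfl
    · exact h.wch_of_sums _ 0 0 b1 b2
    · exact h.wch_of_sums _ 0 0 b3 b4
    · exact h.wch_of_sums _ 0 0 b5 b6
    · exact h.wch_of_sums _ 0 0 b7 b8
    · exact h.wch_of_sums _ 0 0 b9 b10
    · exact h.wch_of_sums _ 0 0 b11 b12
    · exact h.wch_of_sums _ 0 0 b13 b14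
  · simp only [freeReps, List.mem_cons, List.not_mem_nil, or_false] at hr
    rcases hr with rfl | rfl | rfl | rfl | rfl | rfl | rfl | rfl | rfl | rfl | rfl | rfl | rfl | rfl | rfl
    · exact h.wch_of_reSum _ (by decide) _ a1
    · exact h.wch_of_reSum _ (by decide) _ a2
    · exact h.wch_of_reSum _ (by decide) _ a3
    · exact h.wch_of_reSum _ (by decide) _ a4
    · exact h.wch_of_reSum _ (by decide) _ a5
    · exact h.wch_of_reSum _ (by decide) _ a6
    · exact h.wch_of_reSum _ (by decide) _ a7
    · exact h.wch_of_reSum _ (by decide) _ a8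
    · exact h.wch_of_reSum _ (by decide) _ a9
    · exact h.wch_of_reSum _ (by decide) _ a10
    · exact h.wch_of_reSum _ (by decide) _ a11
    · exact h.wch_of_reSum _ (by decide) _ a12
    · exact h.wch_of_reSum _ (by decide) _ a13
    · exact h.wch_of_reSum _ (by decide) _ a14
    · exact h.wch_of_reSum _ (by decide) _ a15

end DesignCert


/-! # THE DESIGNS -/

namespace DC1728

/-! ## §1 `DC1728`: `f = 1728` letters on 128 distinct cells (7 `G₁`-orbits), `P = apex × 1725`, types `(α; β) × m` = (1,1,1,3; 0,0,0,0) × 32; (1,1,2,2; 0,0,0,0) × 64; (1,2,2,3; 0,0,0,2) × 16; (2,2,3,3; 0,0,0,0) × 64; (3,3,3,3; 1+1i,1+1i,1+1i,1+1i) × 1; `μ = (-256, 0)` -/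

/-! ### §1.1 Data -/

/-- level `N`: G₁-orbit representatives 1–4 of 7 (the orbit's minimal `key`) with their multiplicities, `(α, Re β, Im β)` per factor. -/
def repsN_1 : List (MCell × ℤ) :=
  [(mcellOf (1, 0, 0) (1, 0, 0) (1, 0, 0) (3, 0, 0), 32),
   (mcellOf (1, 0, 0) (1, 0, 0) (2, 0, 0) (2, 0, 0), 64),
   (mcellOf (1, 0, 0) (2, 0, 0) (2, 0, 0) (3, -2, 0), 16),
   (mcellOf (2, 0, 0) (2, 0, 0) (3, 0, 0) (3, 0, 0), 64)]

/-- level `N`: G₁-orbit representatives 5–7 of 7 (the orbit's minimal `key`) with their multiplicities, `(α, Re β, Im β)` per factor. -/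
def repsN_2 : List (MCell × ℤ) :=
  [(mcellOf (3, -1, -1) (3, -1, -1) (3, -1, -1) (3, -1, -1), 1),
   (mcellOf (3, -1, -1) (3, -1, -1) (3, -1, 1) (3, 1, -1), 1),
   (mcellOf (3, -1, -1) (3, -1, -1) (3, 1, 1) (3, 1, 1), 1)]

/-- level `N`: all 7 representatives (7 orbits). -/
def repsN : List (MCell × ℤ) := repsN_1 ++ repsN_2

/-- level `N`: the 128 transversal codes `i·96 + s·4 + j` of its cells in increasing `key` order, packed base 8192 (13 bits each). -/
def packedN : ℕ :=
  27836837349251209620057935070858951051237215961390325560425537994243302905704334924803927638648598263971856338332586307182119347282555540895524395303255083189341294850164026001183379821810119289013542916868533829568846368428587798307483723730209390509734890331788362197870504492738783057277402946953476450028820583296677715609591354844472497214211576369199650397929581682818526856162845479721351109077958520684965051256348601937579943002040802097418523529925119034149134516726908473208665885580722176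

/-- level `N`: the 128 cells with multiplicities, GENERATED IN THE KERNEL from `repsN` and `packedN`. -/
def LN : List (MCell × ℤ) := genList repsN (unpack 8192 128 packedN)

/-- level `N`: its search tree. -/
def tN : CT := treeOf LN

/-- level `P`: G₁-orbit representatives 1–1 of 1 (the orbit's minimal `key`) with their multiplicities, `(α, Re β, Im β)` per factor. -/
def repsP_1 : List (MCell × ℤ) :=
  [(mcellOf (0, 0, 0) (0, 0, 0) (0, 0, 0) (0, 0, 0), 1725)]

/-- level `P`: all 1 representatives (1 orbits). -/
def repsP : List (MCell × ℤ) := repsP_1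

/-- level `P`: the 1 transversal codes `i·96 + s·4 + j` of its cells in increasing `key` order, packed base 8192 (13 bits each). -/
def packedP : ℕ :=
  0

/-- level `P`: the 1 cells with multiplicities, GENERATED IN THE KERNEL from `repsP` and `packedP`. -/
def LP : List (MCell × ℤ) := genList repsP (unpack 8192 1 packedP)

/-- level `P`: its search tree. -/
def tP : CT := treeOf LP

/-! ### §1.2 Certified levels (kernel decides) -/

/-- `N`: the tree's in-order entries ARE the generated list. [kernel `decide`, O(n)] -/
theorem tN_entries : tN.entries = LN := by decide +kernel
/-- `N`: every multiplicity is positive. [kernel `decide`] -/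
theorem LN_pos : allB LN (fun p => decide (0 < p.2)) = true := by decide +kernel
/-- `N`: every entry passes the closure check (own lookup, three adjacent transpositions, `Δ`). [kernel `decide`] -/
theorem LN_closed : allB LN (closureCheck tN) = true := by decide +kernel
/-- `N`: the cells come in strictly increasing `key` order (⇒ no duplicates). [kernel `decide`] -/
theorem LN_keys : chainB ((LN.map Prod.fst).map key) = true := by decide +kernel
/-- `N`: 128 cells, total multiplicity 1728. [kernel `decide`] -/
theorem LN_size : LN.length = 128 ∧ msum LN 0 = 1728 := by constructor <;> decide +kernel
/-- `N` is a certified level. -/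
theorem certN : LevelCert LN tN := levelCert_of LN tN tN_entries LN_pos LN_closed

/-- `P`: the tree's in-order entries ARE the generated list. [kernel `decide`, O(n)] -/
theorem tP_entries : tP.entries = LP := by decide +kernel
/-- `P`: every multiplicity is positive. [kernel `decide`] -/
theorem LP_pos : allB LP (fun p => decide (0 < p.2)) = true := by decide +kernel
/-- `P`: every entry passes the closure check (own lookup, three adjacent transpositions, `Δ`). [kernel `decide`] -/
theorem LP_closed : allB LP (closureCheck tP) = true := by decide +kernel
/-- `P`: the cells come in strictly increasing `key` order (⇒ no duplicates). [kernel `decide`] -/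
theorem LP_keys : chainB ((LP.map Prod.fst).map key) = true := by decide +kernel
/-- `P`: 1 cells, total multiplicity 1725. [kernel `decide`] -/
theorem LP_size : LP.length = 1 ∧ msum LP 0 = 1725 := by constructor <;> decide +kernel
/-- `P` is a certified level. -/
theorem certP : LevelCert LP tP := levelCert_of LP tP tP_entries LP_pos LP_closed

/-- **THE (RANK-3) DESIGN IS CERTIFIED** (`DesignCert`: both levels certified, cells in key order). -/
theorem design : DesignCert LN LP tN tP := ⟨certN, certP, isChain_of_chainB _ LN_keys, isChain_of_chainB _ LP_keys⟩

/-- the configuration (support) of the design. -/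
def cfg : MConfig := design.cfg
/-- the multiplicity function of the `N`-cells (the letters of `F`). -/
def mN : MCell → ℤ := mT tN
/-- the multiplicity function of the `P`-cells (the apex letter of `𝒪`, multiplicity `f − 3`). -/
def mP : MCell → ℤ := mT tP

/-- **THE SUPPORT IS `G₁`-CLOSED**: both levels `S₄`-closed and `Δ`-closed. -/
theorem g1Closed : PermClosed cfg.lower ∧ PermClosed cfg.upper ∧ DeltaClosed cfg.lower ∧ DeltaClosed cfg.upper := design.g1

/-- **THE MULTIPLICITIES ARE `G₁`-INVARIANT** (as functions on all cells; `0` off the support). -/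
theorem mult_invariant : (∀ σ Z, mN (MCell.perm σ Z) = mN Z) ∧ (∀ σ P, mP (MCell.perm σ P) = mP P) ∧
    (∀ Z, mN Z.delta = mN Z) ∧ (∀ P, mP P.delta = mP P) :=
  ⟨design.certN.pInv, design.certP.pInv, design.certN.dInv, design.certP.dInv⟩

/-- the multiplicities are positive on the support and zero off it. -/
theorem mult_pos : (∀ Z ∈ cfg.lower, 0 < mN Z) ∧ (∀ P ∈ cfg.upper, 0 < mP P) ∧ (∀ Z, Z ∉ cfg.lower → mN Z = 0) ∧ (∀ P, P ∉ cfg.upper → mP P = 0) :=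
  design.mult_pos

/-- cell counts and multiplicity totals of the two levels (`f = Σ m_N` letters, `Σ m_P = f − 3`). -/
theorem sizes : LN.length = 128 ∧ msum LN 0 = 1728 ∧ LP.length = 1 ∧ msum LP 0 = 1725 := ⟨LN_size.1, LN_size.2, LP_size.1, LP_size.2⟩

/-! ### §1.3 Shape of the support (kernel decides) -/

/-- every `N`-cell is an ISOTROPIC AMPLE box letter: on every factor `α > 0` and `α² > (Re β)² + (Im β)²` (the letter `α(u+v) + βe + β̄ē` of an
ample line bundle on the factor), and the `P`-level is the single APEX cell `(0,0,0)⁴` (the letter of `𝒪`). [kernel `decide`] -/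
theorem shape_all : allB LN (fun p => decide (∀ f, 0 < (p.1 f).1 ∧ (p.1 f).2.1 ^ 2 + (p.1 f).2.2 ^ 2 < (p.1 f).1 ^ 2)) = true ∧
    LP.map Prod.fst = [mcellOf (0, 0, 0) (0, 0, 0) (0, 0, 0) (0, 0, 0)] := by
  constructor <;> decide +kernel

/-- **THE LETTERS OF `F` ARE AMPLE AND ISOTROPIC, `P` IS THE APEX**: `∀ Z ∈ cfg.lower, ∀ f, 0 < α_f(Z) ∧ |β_f(Z)|² < α_f(Z)²`, and
`cfg.upper = {(0,0,0)⁴}` as a membership statement. -/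
theorem shape : (∀ Z ∈ cfg.lower, ∀ f, 0 < (Z f).1 ∧ (Z f).2.1 ^ 2 + (Z f).2.2 ^ 2 < (Z f).1 ^ 2) ∧
    ∀ P, P ∈ cfg.upper ↔ P = mcellOf (0, 0, 0) (0, 0, 0) (0, 0, 0) (0, 0, 0) :=
  ⟨fun Z hZ => by obtain ⟨p, hp, rfl⟩ := List.mem_map.1 (design.mem_lower.1 hZ); exact forall_of_allB shape_all.1 p hp,
   fun P => design.mem_upper.trans
     (by rw [shape_all.2]; simp : P ∈ LP.map Prod.fst ↔ P = mcellOf (0, 0, 0) (0, 0, 0) (0, 0, 0) (0, 0, 0))⟩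

/-! ### §1.4 The class tensor `ch(F) − (f−3)·ch(𝒪)`: two ONE-PASS evaluations over the 129 cells in exact integer arithmetic (kernel decides) -/

/-- the e-free coefficient by degree `0 … 8` (the `ℚ[h]`-part `Σ q_k h^k∕k!` of `ch(F − 𝒪^{f−3})`, coefficient on e-free words of degree `k`). -/
def q (k : ℕ) : ℤ :=
  match k with
  | 0 => 3 | 1 => 3456 | 2 => 6976 | 3 => 14336 | 4 => 30144 | 5 => 64896 | 6 => 142656 | 7 => 318720 | _ => 720064

/-- **the 15 e-free representative sums** (`Σ_N m·ch − Σ_P m·ch` at `freeReps`, real parts; imaginary parts vanish by `imSum_zero`). [kernel `decide`] -/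
theorem sumA_val : sumA (LN ++ negM LP) 0 0 0 0 0 0 0 0 0 0 0 0 0 0 0 =
    [3, 3456, 6976, 14336, 30144, 6976, 14336, 30144, 64896, 30144, 64896, 142656, 142656, 318720, 720064] := by
  decide +kernel

/-- **the 7 mixed representative sums and the `eeee` sum** (re∕im pairs). [kernel `decide`] -/
theorem sumB_val : sumB (LN ++ negM LP) 0 0 0 0 0 0 0 0 0 0 0 0 0 0 0 0 =
    [0, 0, 0, 0, 0, 0, 0, 0, 0, 0, 0, 0, 0, 0, -256, 0] := by
  decide +kernel

theorem sumA_val' : sumA (LN ++ negM LP) 0 0 0 0 0 0 0 0 0 0 0 0 0 0 0 =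
    [q 0, q 1, q 2, q 3, q 4, q 2, q 3, q 4, q 5, q 4, q 5, q 6, q 6, q 7, q 8] := by
  rw [sumA_val]; rfl

/-! ### §1.5 The theorems (tree vocabulary): C0 at virtual rank 3 -/

/-- **(A1) IN ALL DEGREES: THE WEIGHTED CLASS TENSOR `ch(F) − (f−3)·ch(𝒪)` PASSES THE CLASS SCREEN** (`Pad4TowerClassScreen.ClassScreen`, both clauses,
all `1296` words), **and μ = ⟨-256, 0⟩**. -/
theorem classScreen_and_mu : ClassScreen (cfg.wch mN mP) ∧ cfg.wch mN mP eWord = ⟨-256, 0⟩ :=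
  design.classScreen_of_sums q (-256) (0) sumA_val' sumB_val

/-- **(A1).** -/
theorem classScreen : ClassScreen (cfg.wch mN mP) := classScreen_and_mu.1

/-- … equivalently `ch ∈ ℚ[h] ⊕ W` (`Pad4TowerClassScreen.inQhW_iff_classScreen`). -/
theorem inQhW : InQhW (cfg.wch mN mP) := (inQhW_iff_classScreen _).2 classScreen

/-- **μ = -256** (the `eeee` coefficient of the weighted class tensor, in `ℤ[i]`; the virtual `W`-coordinate of `c₄(F − 𝒪^{f−3})` is `−6μ`, pencil ∕
`SeedCheckerPorteous.virtChernFour_eq_of_virtCleanAtSeed`). -/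
theorem mu : cfg.wch mN mP eWord = ⟨-256, 0⟩ := classScreen_and_mu.2

/-- **μ ≠ 0.** -/
theorem mu_ne_zero : cfg.wch mN mP eWord ≠ 0 := by rw [mu]; decide

/-- **RANK 3**: `Σ m_N − Σ m_P = 3` (the virtual rank of `F − 𝒪^{f−3}`). -/
theorem rank : ((∑ Z ∈ cfg.lower, mN Z) - ∑ P ∈ cfg.upper, mP P : ℤ) = 3 := by
  have h := design.rank; rw [LN_size.2, LP_size.2] at h; exact h

/-- the rank as the `1111` coefficient of the class tensor. -/
theorem wch_one : cfg.wch mN mP ![0, 0, 0, 0] = (3 : ℤ) := by rw [wch_one_eq]; exact_mod_cast rank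

/-- the e-free coefficients by degree: `wch w = q (wdeg w)` for every e-free word `w` (the `ℚ[h]` part). -/
theorem wch_eFree (w : CWord) (hw : EFree w) : cfg.wch mN mP w = ⟨q (wdeg w), 0⟩ := by
  obtain ⟨σ, -, hr⟩ := free_cover w hw
  obtain ⟨g1, g2, -, -⟩ := design.g1
  rw [← wch_uvNorm, ← cfg.wch_permW_of_permInvariant g1 g2 mN mP design.certN.pInv design.certP.pInv σ (uvNorm w), ← wdeg_uvNorm w,
    ← wdeg_permW σ (uvNorm w)]
  have hA := sumA_val'
  rw [sumA_eq] at hA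
  simp only [zero_add, List.cons.injEq, and_true] at hA
  obtain ⟨a1, a2, a3, a4, a5, a6, a7, a8, a9, a10, a11, a12, a13, a14, a15⟩ := hA
  simp only [freeReps, List.mem_cons, List.not_mem_nil, or_false] at hr
  generalize permW σ (uvNorm w) = r at hr ⊢
  rcases hr with rfl | rfl | rfl | rfl | rfl | rfl | rfl | rfl | rfl | rfl | rfl | rfl | rfl | rfl | rfl
  · exact design.wch_of_reSum _ (by decide) _ a1
  · exact design.wch_of_reSum _ (by decide) _ a2
  · exact design.wch_of_reSum _ (by decide) _ a3
  · exact design.wch_of_reSum _ (by decide) _ a4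
  · exact design.wch_of_reSum _ (by decide) _ a5
  · exact design.wch_of_reSum _ (by decide) _ a6
  · exact design.wch_of_reSum _ (by decide) _ a7
  · exact design.wch_of_reSum _ (by decide) _ a8
  · exact design.wch_of_reSum _ (by decide) _ a9
  · exact design.wch_of_reSum _ (by decide) _ a10
  · exact design.wch_of_reSum _ (by decide) _ a11
  · exact design.wch_of_reSum _ (by decide) _ a12
  · exact design.wch_of_reSum _ (by decide) _ a13
  · exact design.wch_of_reSum _ (by decide) _ a14
  · exact design.wch_of_reSum _ (by decide) _ a15

/-! ### §1.6 The rank-4 json key `D₄ = (N, apex × (f−4))`: the tree's json move `SeedChecker.Design.padApexUp 0 1` (one apex `P`-cell more) turns it into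
the rank-3 design of §1.1–§1.5 cell for cell (pencil: same `N`, `P`-multiplicity `f − 4 + 1 = f − 3`); C0 at rank 4 is what `Design.ClassData` ∕
`Design.seedCheck_of_twoTermDegeneracy` key on. Certified here in the same vocabulary. -/

/-- level `K`: the apex with multiplicity `f − 4 = 1724`. -/
def repsK : List (MCell × ℤ) := [(mcellOf (0, 0, 0) (0, 0, 0) (0, 0, 0) (0, 0, 0), 1724)]
/-- level `K`: generated list (one cell, code `0`) and tree. -/
def LK : List (MCell × ℤ) := genList repsK (unpack 8192 1 0)
def tK : CT := treeOf LK

theorem tK_entries : tK.entries = LK := by decide +kernel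
theorem LK_pos : allB LK (fun p => decide (0 < p.2)) = true := by decide +kernel
theorem LK_closed : allB LK (closureCheck tK) = true := by decide +kernel
theorem LK_keys : chainB ((LK.map Prod.fst).map key) = true := by decide +kernel
theorem LK_size : LK.length = 1 ∧ msum LK 0 = 1724 := by constructor <;> decide +kernel
theorem certK : LevelCert LK tK := levelCert_of LK tK tK_entries LK_pos LK_closed

/-- **THE RANK-4 KEY DESIGN IS CERTIFIED.** -/
theorem design4 : DesignCert LN LK tN tK := ⟨certN, certK, isChain_of_chainB _ LN_keys, isChain_of_chainB _ LK_keys⟩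
/-- its configuration and `P`-multiplicity function (the `N` side is `mN`). -/
def cfg4 : MConfig := design4.cfg
def mK : MCell → ℤ := mT tK

/-- level `K` has the single apex cell. [kernel `decide`] -/
theorem LK_cells : LK.map Prod.fst = [mcellOf (0, 0, 0) (0, 0, 0) (0, 0, 0) (0, 0, 0)] := by decide +kernel
/-- the same `P`-cell and the same `N`-cells: `cfg4.upper = cfg.upper`, `cfg4.lower = cfg.lower` as membership statements. -/
theorem cfg4_upper (P : MCell) : P ∈ cfg4.upper ↔ P ∈ cfg.upper :=
  (design4.mem_upper.trans (by rw [LK_cells, shape_all.2] : P ∈ LK.map Prod.fst ↔ P ∈ LP.map Prod.fst)).trans design.mem_upper.symm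
theorem cfg4_lower (Z : MCell) : Z ∈ cfg4.lower ↔ Z ∈ cfg.lower := Iff.rfl

theorem sumA4_val : sumA (LN ++ negM LK) 0 0 0 0 0 0 0 0 0 0 0 0 0 0 0 =
    [4, 3456, 6976, 14336, 30144, 6976, 14336, 30144, 64896, 30144, 64896, 142656, 142656, 318720, 720064] := by
  decide +kernel
theorem sumB4_val : sumB (LN ++ negM LK) 0 0 0 0 0 0 0 0 0 0 0 0 0 0 0 0 =
    [0, 0, 0, 0, 0, 0, 0, 0, 0, 0, 0, 0, 0, 0, -256, 0] := by
  decide +kernel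
/-- the key's e-free coefficients: `q` with `q 0 = 4`. -/
def q4 (k : ℕ) : ℤ := match k with | 0 => 4 | k => q k
theorem sumA4_val' : sumA (LN ++ negM LK) 0 0 0 0 0 0 0 0 0 0 0 0 0 0 0 =
    [q4 0, q4 1, q4 2, q4 3, q4 4, q4 2, q4 3, q4 4, q4 5, q4 4, q4 5, q4 6, q4 6, q4 7, q4 8] := by
  rw [sumA4_val]; rfl

/-- **C0 AT RANK 4 OF THE KEY**: (A1) in all degrees, the same `μ = ⟨-256, 0⟩ ≠ 0`, rank `4`, positive multiplicities. -/
theorem key_classScreen_and_mu : ClassScreen (cfg4.wch mN mK) ∧ cfg4.wch mN mK eWord = ⟨-256, 0⟩ :=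
  design4.classScreen_of_sums q4 (-256) (0) sumA4_val' sumB4_val
theorem key_mu_ne_zero : cfg4.wch mN mK eWord ≠ 0 := by rw [key_classScreen_and_mu.2]; decide
theorem key_rank : ((∑ Z ∈ cfg4.lower, mN Z) - ∑ P ∈ cfg4.upper, mK P : ℤ) = 4 := by
  have h := design4.rank; rw [LN_size.2, LK_size.2] at h; exact h
theorem key_mult_pos : (∀ Z ∈ cfg4.lower, 0 < mN Z) ∧ (∀ P ∈ cfg4.upper, 0 < mK P) ∧ (∀ Z, Z ∉ cfg4.lower → mN Z = 0) ∧ (∀ P, P ∉ cfg4.upper → mK P = 0) :=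
  design4.mult_pos
/-- the key's `P`-multiplicity is `f − 4`, the design's is `f − 3`: one apex more. -/
theorem key_pad : mK (mcellOf (0, 0, 0) (0, 0, 0) (0, 0, 0) (0, 0, 0)) + 1 = mP (mcellOf (0, 0, 0) (0, 0, 0) (0, 0, 0) (0, 0, 0)) := by
  decide +kernel

/-! ### §1.7 Bridge to the door's vocabulary `SeedChecker.Design` (`SeedChecker.lean` §1, `SeedCheckerPorteous.lean` §8.5–§8.6): the rank-3 design
`D₃ = ⟨cfg, mN, mP⟩` is `Clean` with `ClassDataR 3`, the rank-4 key `D₄ = ⟨cfg4, mN, mK⟩` has `ClassData`, `μ(D₃) = μ(D₄)`, and `D₄.padApexUp 0 1 = D₃`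
literally — i.e. exactly the json hypotheses `hC0 : D.ClassData`, `hD' : D'.Clean`, `hmu : D'.mu = D.mu` of `Design.seedCheck_of_twoTermDegeneracy`
with `D = D₄`, `D' = D₃`. (The door's OTHER hypotheses — word kit, two-term realisation, the law, C5–C7 of the degeneracy scheme — are not touched.) -/

/-- the rank-3 design `(N, apex × (f−3))` as a `SeedChecker.Design` (the `D'` of the two-term door). -/
def D₃ : SeedChecker.Design := ⟨cfg, mN, mP⟩
/-- the rank-4 key `(N, apex × (f−4))` as a `SeedChecker.Design` (the `D` of the two-term door). -/
def D₄ : SeedChecker.Design := ⟨cfg4, mN, mK⟩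

theorem D₃_clean : D₃.Clean := classScreen
theorem D₃_mu : D₃.mu = ⟨-256, 0⟩ := mu
theorem D₃_rank : D₃.rank = 3 := by show cfg.wch mN mP ![0, 0, 0, 0] = 3; rw [wch_one]; norm_num
theorem D₃_positive : D₃.Positive := ⟨mult_pos.1, mult_pos.2.1⟩
/-- **C0 AT RANK 3 in the door's vocabulary.** -/
theorem D₃_classDataR : D₃.ClassDataR 3 := ⟨D₃_clean, mu_ne_zero, by exact_mod_cast D₃_rank, D₃_positive⟩

theorem D₄_clean : D₄.Clean := key_classScreen_and_mu.1
theorem D₄_mu : D₄.mu = ⟨-256, 0⟩ := key_classScreen_and_mu.2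
theorem D₄_rank : D₄.rank = 4 := by show cfg4.wch mN mK ![0, 0, 0, 0] = 4; rw [wch_one_eq]; exact_mod_cast key_rank
theorem D₄_positive : D₄.Positive := ⟨key_mult_pos.1, key_mult_pos.2.1⟩
/-- **C0 AT RANK 4 OF THE KEY in the door's vocabulary** (`hC0`). -/
theorem D₄_classData : D₄.ClassData := ⟨D₄_clean, key_mu_ne_zero, D₄_rank, D₄_positive⟩
/-- `μ(D') = μ(D)` (`hmu`). -/
theorem D₃_mu_eq_D₄_mu : D₃.mu = D₄.mu := by rw [D₃_mu, D₄_mu]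

/-- the door's apex cell of twist `0` is this file's apex cell. -/
theorem apexCell_zero : SeedChecker.apexCell 0 = mcellOf (0, 0, 0) (0, 0, 0) (0, 0, 0) (0, 0, 0) := by
  funext f; fin_cases f <;> rfl

/-- **THE JSON MOVE, LITERALLY**: padding the key with one apex `P`-cell of twist `0` gives the rank-3 design (`SeedCheckerPorteous` §8.6). -/
theorem D₄_padApexUp : D₄.padApexUp 0 1 = D₃ := by
  have hup : insert (SeedChecker.apexCell 0) cfg4.upper = cfg.upper := by
    ext P; rw [Finset.mem_insert, cfg4_upper, shape.2 P, apexCell_zero]; simp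
  have hmP : (fun P => (if P ∈ cfg4.upper then mK P else 0) + (if P = SeedChecker.apexCell 0 then (1 : ℤ) else 0)) = mP := by
    funext P
    by_cases hP : P = mcellOf (0, 0, 0) (0, 0, 0) (0, 0, 0) (0, 0, 0)
    · subst hP
      rw [if_pos ((cfg4_upper _).2 ((shape.2 _).2 rfl)), apexCell_zero, if_pos rfl]; exact key_pad
    · have h4 : P ∉ cfg4.upper := fun h => hP ((shape.2 P).1 ((cfg4_upper P).1 h))
      have h3 : P ∉ cfg.upper := fun h => hP ((shape.2 P).1 h)
      rw [if_neg h4, apexCell_zero, if_neg hP, zero_add]; exact (mult_pos.2.2.2 P h3).symm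
  show (⟨⟨cfg4.lower, insert (SeedChecker.apexCell 0) cfg4.upper⟩, mN,
      fun P => (if P ∈ cfg4.upper then mK P else 0) + (if P = SeedChecker.apexCell 0 then (1 : ℤ) else 0)⟩ : SeedChecker.Design) = ⟨cfg, mN, mP⟩
  rw [hup, hmP]; rfl

end DC1728

namespace DC964

/-! ## §2 `DC964`: `f = 964` letters on 218 distinct cells (8 `G₁`-orbits), `P = apex × 961`, types `(α; β) × m` = (1,1,1,2; 0,0,0,0) × 32; (1,1,3,3; 0,0,0,0) × 14; (1,2,3,3; 0,1,0,0) × 5; (1,3,3,3; 0,0,0,1) × 4; (2,2,3,3; 0,0,0,2+2i) × 4; (3,3,3,3; 1,1,1,1) × 2; `μ = (128, 0)` -/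

/-! ### §2.1 Data -/

/-- level `N`: G₁-orbit representatives 1–4 of 8 (the orbit's minimal `key`) with their multiplicities, `(α, Re β, Im β)` per factor. -/
def repsN_1 : List (MCell × ℤ) :=
  [(mcellOf (1, 0, 0) (1, 0, 0) (1, 0, 0) (2, 0, 0), 32),
   (mcellOf (1, 0, 0) (1, 0, 0) (3, 0, 0) (3, 0, 0), 14),
   (mcellOf (1, 0, 0) (2, -1, 0) (3, 0, 0) (3, 0, 0), 5),
   (mcellOf (1, 0, 0) (3, -1, 0) (3, 0, 0) (3, 0, 0), 4)]

/-- level `N`: G₁-orbit representatives 5–8 of 8 (the orbit's minimal `key`) with their multiplicities, `(α, Re β, Im β)` per factor. -/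
def repsN_2 : List (MCell × ℤ) :=
  [(mcellOf (2, 0, 0) (2, 0, 0) (3, -2, -2) (3, 0, 0), 4),
   (mcellOf (3, -1, 0) (3, -1, 0) (3, -1, 0) (3, -1, 0), 2),
   (mcellOf (3, -1, 0) (3, -1, 0) (3, 0, -1) (3, 0, 1), 2),
   (mcellOf (3, -1, 0) (3, -1, 0) (3, 1, 0) (3, 1, 0), 2)]

/-- level `N`: all 8 representatives (8 orbits). -/
def repsN : List (MCell × ℤ) := repsN_1 ++ repsN_2

/-- level `N`: the 218 transversal codes `i·96 + s·4 + j` of its cells in increasing `key` order, packed base 8192 (13 bits each). -/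
def packedN : ℕ :=
  722573260052688449034604571219243962282763081923274251602601524721509661503509537700702854787083487579721462952624045401988420056333913934400829765677780444543480554471543187463879899473665457054914482596661134893803269380734667092349237585696401383520981674494688429676119009664297222061804068001120854394074182721266144731373452356939143058616216149641106347466261912238427380375120878907980814462732503019739207158831180770194881433290069352766725386365042161025996521218590574528433546534885431963951033383085824330680756980361851254347805885979547424038103335355142652421153339133391666515481965200026310650452819201445541237320707665887230040237373219210194265527600379693157549970358760259305792069053974628607981594172200612926201880651373712304667835749343663243332566817088602751396649560967080335159905298757317918484142145802896438758244352

/-- level `N`: the 218 cells with multiplicities, GENERATED IN THE KERNEL from `repsN` and `packedN`. -/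
def LN : List (MCell × ℤ) := genList repsN (unpack 8192 218 packedN)

/-- level `N`: its search tree. -/
def tN : CT := treeOf LN

/-- level `P`: G₁-orbit representatives 1–1 of 1 (the orbit's minimal `key`) with their multiplicities, `(α, Re β, Im β)` per factor. -/
def repsP_1 : List (MCell × ℤ) :=
  [(mcellOf (0, 0, 0) (0, 0, 0) (0, 0, 0) (0, 0, 0), 961)]

/-- level `P`: all 1 representatives (1 orbits). -/
def repsP : List (MCell × ℤ) := repsP_1

/-- level `P`: the 1 transversal codes `i·96 + s·4 + j` of its cells in increasing `key` order, packed base 8192 (13 bits each). -/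
def packedP : ℕ :=
  0

/-- level `P`: the 1 cells with multiplicities, GENERATED IN THE KERNEL from `repsP` and `packedP`. -/
def LP : List (MCell × ℤ) := genList repsP (unpack 8192 1 packedP)

/-- level `P`: its search tree. -/
def tP : CT := treeOf LP

/-! ### §2.2 Certified levels (kernel decides) -/

/-- `N`: the tree's in-order entries ARE the generated list. [kernel `decide`, O(n)] -/
theorem tN_entries : tN.entries = LN := by decide +kernel
/-- `N`: every multiplicity is positive. [kernel `decide`] -/
theorem LN_pos : allB LN (fun p => decide (0 < p.2)) = true := by decide +kernel
/-- `N`: every entry passes the closure check (own lookup, three adjacent transpositions, `Δ`). [kernel `decide`] -/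
theorem LN_closed : allB LN (closureCheck tN) = true := by decide +kernel
/-- `N`: the cells come in strictly increasing `key` order (⇒ no duplicates). [kernel `decide`] -/
theorem LN_keys : chainB ((LN.map Prod.fst).map key) = true := by decide +kernel
/-- `N`: 218 cells, total multiplicity 964. [kernel `decide`] -/
theorem LN_size : LN.length = 218 ∧ msum LN 0 = 964 := by constructor <;> decide +kernel
/-- `N` is a certified level. -/
theorem certN : LevelCert LN tN := levelCert_of LN tN tN_entries LN_pos LN_closed

/-- `P`: the tree's in-order entries ARE the generated list. [kernel `decide`, O(n)] -/
theorem tP_entries : tP.entries = LP := by decide +kernel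
/-- `P`: every multiplicity is positive. [kernel `decide`] -/
theorem LP_pos : allB LP (fun p => decide (0 < p.2)) = true := by decide +kernel
/-- `P`: every entry passes the closure check (own lookup, three adjacent transpositions, `Δ`). [kernel `decide`] -/
theorem LP_closed : allB LP (closureCheck tP) = true := by decide +kernel
/-- `P`: the cells come in strictly increasing `key` order (⇒ no duplicates). [kernel `decide`] -/
theorem LP_keys : chainB ((LP.map Prod.fst).map key) = true := by decide +kernel
/-- `P`: 1 cells, total multiplicity 961. [kernel `decide`] -/
theorem LP_size : LP.length = 1 ∧ msum LP 0 = 961 := by constructor <;> decide +kernel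
/-- `P` is a certified level. -/
theorem certP : LevelCert LP tP := levelCert_of LP tP tP_entries LP_pos LP_closed

/-- **THE (RANK-3) DESIGN IS CERTIFIED** (`DesignCert`: both levels certified, cells in key order). -/
theorem design : DesignCert LN LP tN tP := ⟨certN, certP, isChain_of_chainB _ LN_keys, isChain_of_chainB _ LP_keys⟩

/-- the configuration (support) of the design. -/
def cfg : MConfig := design.cfg
/-- the multiplicity function of the `N`-cells (the letters of `F`). -/
def mN : MCell → ℤ := mT tN
/-- the multiplicity function of the `P`-cells (the apex letter of `𝒪`, multiplicity `f − 3`). -/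
def mP : MCell → ℤ := mT tP

/-- **THE SUPPORT IS `G₁`-CLOSED**: both levels `S₄`-closed and `Δ`-closed. -/
theorem g1Closed : PermClosed cfg.lower ∧ PermClosed cfg.upper ∧ DeltaClosed cfg.lower ∧ DeltaClosed cfg.upper := design.g1

/-- **THE MULTIPLICITIES ARE `G₁`-INVARIANT** (as functions on all cells; `0` off the support). -/
theorem mult_invariant : (∀ σ Z, mN (MCell.perm σ Z) = mN Z) ∧ (∀ σ P, mP (MCell.perm σ P) = mP P) ∧
    (∀ Z, mN Z.delta = mN Z) ∧ (∀ P, mP P.delta = mP P) :=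
  ⟨design.certN.pInv, design.certP.pInv, design.certN.dInv, design.certP.dInv⟩

/-- the multiplicities are positive on the support and zero off it. -/
theorem mult_pos : (∀ Z ∈ cfg.lower, 0 < mN Z) ∧ (∀ P ∈ cfg.upper, 0 < mP P) ∧ (∀ Z, Z ∉ cfg.lower → mN Z = 0) ∧ (∀ P, P ∉ cfg.upper → mP P = 0) :=
  design.mult_pos

/-- cell counts and multiplicity totals of the two levels (`f = Σ m_N` letters, `Σ m_P = f − 3`). -/
theorem sizes : LN.length = 218 ∧ msum LN 0 = 964 ∧ LP.length = 1 ∧ msum LP 0 = 961 := ⟨LN_size.1, LN_size.2, LP_size.1, LP_size.2⟩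

/-! ### §2.3 Shape of the support (kernel decides) -/

/-- every `N`-cell is an ISOTROPIC AMPLE box letter: on every factor `α > 0` and `α² > (Re β)² + (Im β)²` (the letter `α(u+v) + βe + β̄ē` of an
ample line bundle on the factor), and the `P`-level is the single APEX cell `(0,0,0)⁴` (the letter of `𝒪`). [kernel `decide`] -/
theorem shape_all : allB LN (fun p => decide (∀ f, 0 < (p.1 f).1 ∧ (p.1 f).2.1 ^ 2 + (p.1 f).2.2 ^ 2 < (p.1 f).1 ^ 2)) = true ∧
    LP.map Prod.fst = [mcellOf (0, 0, 0) (0, 0, 0) (0, 0, 0) (0, 0, 0)] := by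
  constructor <;> decide +kernel

/-- **THE LETTERS OF `F` ARE AMPLE AND ISOTROPIC, `P` IS THE APEX**: `∀ Z ∈ cfg.lower, ∀ f, 0 < α_f(Z) ∧ |β_f(Z)|² < α_f(Z)²`, and
`cfg.upper = {(0,0,0)⁴}` as a membership statement. -/
theorem shape : (∀ Z ∈ cfg.lower, ∀ f, 0 < (Z f).1 ∧ (Z f).2.1 ^ 2 + (Z f).2.2 ^ 2 < (Z f).1 ^ 2) ∧
    ∀ P, P ∈ cfg.upper ↔ P = mcellOf (0, 0, 0) (0, 0, 0) (0, 0, 0) (0, 0, 0) :=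
  ⟨fun Z hZ => by obtain ⟨p, hp, rfl⟩ := List.mem_map.1 (design.mem_lower.1 hZ); exact forall_of_allB shape_all.1 p hp,
   fun P => design.mem_upper.trans
     (by rw [shape_all.2]; simp : P ∈ LP.map Prod.fst ↔ P = mcellOf (0, 0, 0) (0, 0, 0) (0, 0, 0) (0, 0, 0))⟩

/-! ### §2.4 The class tensor `ch(F) − (f−3)·ch(𝒪)`: two ONE-PASS evaluations over the 219 cells in exact integer arithmetic (kernel decides) -/

/-- the e-free coefficient by degree `0 … 8` (the `ℚ[h]`-part `Σ q_k h^k∕k!` of `ch(F − 𝒪^{f−3})`, coefficient on e-free words of degree `k`). -/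
def q (k : ℕ) : ℤ :=
  match k with
  | 0 => 3 | 1 => 2212 | 2 => 5148 | 3 => 11996 | 4 => 27796 | 5 => 63860 | 6 => 145452 | 7 => 329068 | _ => 741988

/-- **the 15 e-free representative sums** (`Σ_N m·ch − Σ_P m·ch` at `freeReps`, real parts; imaginary parts vanish by `imSum_zero`). [kernel `decide`] -/
theorem sumA_val : sumA (LN ++ negM LP) 0 0 0 0 0 0 0 0 0 0 0 0 0 0 0 =
    [3, 2212, 5148, 11996, 27796, 5148, 11996, 27796, 63860, 27796, 63860, 145452, 145452, 329068, 741988] := by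
  decide +kernel

/-- **the 7 mixed representative sums and the `eeee` sum** (re∕im pairs). [kernel `decide`] -/
theorem sumB_val : sumB (LN ++ negM LP) 0 0 0 0 0 0 0 0 0 0 0 0 0 0 0 0 =
    [0, 0, 0, 0, 0, 0, 0, 0, 0, 0, 0, 0, 0, 0, 128, 0] := by
  decide +kernel

theorem sumA_val' : sumA (LN ++ negM LP) 0 0 0 0 0 0 0 0 0 0 0 0 0 0 0 =
    [q 0, q 1, q 2, q 3, q 4, q 2, q 3, q 4, q 5, q 4, q 5, q 6, q 6, q 7, q 8] := by
  rw [sumA_val]; rfl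

/-! ### §2.5 The theorems (tree vocabulary): C0 at virtual rank 3 -/

/-- **(A1) IN ALL DEGREES: THE WEIGHTED CLASS TENSOR `ch(F) − (f−3)·ch(𝒪)` PASSES THE CLASS SCREEN** (`Pad4TowerClassScreen.ClassScreen`, both clauses,
all `1296` words), **and μ = ⟨128, 0⟩**. -/
theorem classScreen_and_mu : ClassScreen (cfg.wch mN mP) ∧ cfg.wch mN mP eWord = ⟨128, 0⟩ :=
  design.classScreen_of_sums q (128) (0) sumA_val' sumB_val

/-- **(A1).** -/
theorem classScreen : ClassScreen (cfg.wch mN mP) := classScreen_and_mu.1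

/-- … equivalently `ch ∈ ℚ[h] ⊕ W` (`Pad4TowerClassScreen.inQhW_iff_classScreen`). -/
theorem inQhW : InQhW (cfg.wch mN mP) := (inQhW_iff_classScreen _).2 classScreen

/-- **μ = 128** (the `eeee` coefficient of the weighted class tensor, in `ℤ[i]`; the virtual `W`-coordinate of `c₄(F − 𝒪^{f−3})` is `−6μ`, pencil ∕
`SeedCheckerPorteous.virtChernFour_eq_of_virtCleanAtSeed`). -/
theorem mu : cfg.wch mN mP eWord = ⟨128, 0⟩ := classScreen_and_mu.2

/-- **μ ≠ 0.** -/
theorem mu_ne_zero : cfg.wch mN mP eWord ≠ 0 := by rw [mu]; decide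

/-- **RANK 3**: `Σ m_N − Σ m_P = 3` (the virtual rank of `F − 𝒪^{f−3}`). -/
theorem rank : ((∑ Z ∈ cfg.lower, mN Z) - ∑ P ∈ cfg.upper, mP P : ℤ) = 3 := by
  have h := design.rank; rw [LN_size.2, LP_size.2] at h; exact h

/-- the rank as the `1111` coefficient of the class tensor. -/
theorem wch_one : cfg.wch mN mP ![0, 0, 0, 0] = (3 : ℤ) := by rw [wch_one_eq]; exact_mod_cast rank

/-- the e-free coefficients by degree: `wch w = q (wdeg w)` for every e-free word `w` (the `ℚ[h]` part). -/
theorem wch_eFree (w : CWord) (hw : EFree w) : cfg.wch mN mP w = ⟨q (wdeg w), 0⟩ := by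
  obtain ⟨σ, -, hr⟩ := free_cover w hw
  obtain ⟨g1, g2, -, -⟩ := design.g1
  rw [← wch_uvNorm, ← cfg.wch_permW_of_permInvariant g1 g2 mN mP design.certN.pInv design.certP.pInv σ (uvNorm w), ← wdeg_uvNorm w,
    ← wdeg_permW σ (uvNorm w)]
  have hA := sumA_val'
  rw [sumA_eq] at hA
  simp only [zero_add, List.cons.injEq, and_true] at hA
  obtain ⟨a1, a2, a3, a4, a5, a6, a7, a8, a9, a10, a11, a12, a13, a14, a15⟩ := hA
  simp only [freeReps, List.mem_cons, List.not_mem_nil, or_false] at hr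
  generalize permW σ (uvNorm w) = r at hr ⊢
  rcases hr with rfl | rfl | rfl | rfl | rfl | rfl | rfl | rfl | rfl | rfl | rfl | rfl | rfl | rfl | rfl
  · exact design.wch_of_reSum _ (by decide) _ a1
  · exact design.wch_of_reSum _ (by decide) _ a2
  · exact design.wch_of_reSum _ (by decide) _ a3
  · exact design.wch_of_reSum _ (by decide) _ a4
  · exact design.wch_of_reSum _ (by decide) _ a5
  · exact design.wch_of_reSum _ (by decide) _ a6
  · exact design.wch_of_reSum _ (by decide) _ a7
  · exact design.wch_of_reSum _ (by decide) _ a8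
  · exact design.wch_of_reSum _ (by decide) _ a9
  · exact design.wch_of_reSum _ (by decide) _ a10
  · exact design.wch_of_reSum _ (by decide) _ a11
  · exact design.wch_of_reSum _ (by decide) _ a12
  · exact design.wch_of_reSum _ (by decide) _ a13
  · exact design.wch_of_reSum _ (by decide) _ a14
  · exact design.wch_of_reSum _ (by decide) _ a15

/-! ### §2.6 The rank-4 json key `D₄ = (N, apex × (f−4))`: the tree's json move `SeedChecker.Design.padApexUp 0 1` (one apex `P`-cell more) turns it into
the rank-3 design of §2.1–§2.5 cell for cell (pencil: same `N`, `P`-multiplicity `f − 4 + 1 = f − 3`); C0 at rank 4 is what `Design.ClassData` ∕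
`Design.seedCheck_of_twoTermDegeneracy` key on. Certified here in the same vocabulary. -/

/-- level `K`: the apex with multiplicity `f − 4 = 960`. -/
def repsK : List (MCell × ℤ) := [(mcellOf (0, 0, 0) (0, 0, 0) (0, 0, 0) (0, 0, 0), 960)]
/-- level `K`: generated list (one cell, code `0`) and tree. -/
def LK : List (MCell × ℤ) := genList repsK (unpack 8192 1 0)
def tK : CT := treeOf LK

theorem tK_entries : tK.entries = LK := by decide +kernel
theorem LK_pos : allB LK (fun p => decide (0 < p.2)) = true := by decide +kernel
theorem LK_closed : allB LK (closureCheck tK) = true := by decide +kernel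
theorem LK_keys : chainB ((LK.map Prod.fst).map key) = true := by decide +kernel
theorem LK_size : LK.length = 1 ∧ msum LK 0 = 960 := by constructor <;> decide +kernel
theorem certK : LevelCert LK tK := levelCert_of LK tK tK_entries LK_pos LK_closed

/-- **THE RANK-4 KEY DESIGN IS CERTIFIED.** -/
theorem design4 : DesignCert LN LK tN tK := ⟨certN, certK, isChain_of_chainB _ LN_keys, isChain_of_chainB _ LK_keys⟩
/-- its configuration and `P`-multiplicity function (the `N` side is `mN`). -/
def cfg4 : MConfig := design4.cfg
def mK : MCell → ℤ := mT tK

/-- level `K` has the single apex cell. [kernel `decide`] -/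
theorem LK_cells : LK.map Prod.fst = [mcellOf (0, 0, 0) (0, 0, 0) (0, 0, 0) (0, 0, 0)] := by decide +kernel
/-- the same `P`-cell and the same `N`-cells: `cfg4.upper = cfg.upper`, `cfg4.lower = cfg.lower` as membership statements. -/
theorem cfg4_upper (P : MCell) : P ∈ cfg4.upper ↔ P ∈ cfg.upper :=
  (design4.mem_upper.trans (by rw [LK_cells, shape_all.2] : P ∈ LK.map Prod.fst ↔ P ∈ LP.map Prod.fst)).trans design.mem_upper.symm
theorem cfg4_lower (Z : MCell) : Z ∈ cfg4.lower ↔ Z ∈ cfg.lower := Iff.rfl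

theorem sumA4_val : sumA (LN ++ negM LK) 0 0 0 0 0 0 0 0 0 0 0 0 0 0 0 =
    [4, 2212, 5148, 11996, 27796, 5148, 11996, 27796, 63860, 27796, 63860, 145452, 145452, 329068, 741988] := by
  decide +kernel
theorem sumB4_val : sumB (LN ++ negM LK) 0 0 0 0 0 0 0 0 0 0 0 0 0 0 0 0 =
    [0, 0, 0, 0, 0, 0, 0, 0, 0, 0, 0, 0, 0, 0, 128, 0] := by
  decide +kernel
/-- the key's e-free coefficients: `q` with `q 0 = 4`. -/
def q4 (k : ℕ) : ℤ := match k with | 0 => 4 | k => q k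
theorem sumA4_val' : sumA (LN ++ negM LK) 0 0 0 0 0 0 0 0 0 0 0 0 0 0 0 =
    [q4 0, q4 1, q4 2, q4 3, q4 4, q4 2, q4 3, q4 4, q4 5, q4 4, q4 5, q4 6, q4 6, q4 7, q4 8] := by
  rw [sumA4_val]; rfl

/-- **C0 AT RANK 4 OF THE KEY**: (A1) in all degrees, the same `μ = ⟨128, 0⟩ ≠ 0`, rank `4`, positive multiplicities. -/
theorem key_classScreen_and_mu : ClassScreen (cfg4.wch mN mK) ∧ cfg4.wch mN mK eWord = ⟨128, 0⟩ :=
  design4.classScreen_of_sums q4 (128) (0) sumA4_val' sumB4_val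
theorem key_mu_ne_zero : cfg4.wch mN mK eWord ≠ 0 := by rw [key_classScreen_and_mu.2]; decide
theorem key_rank : ((∑ Z ∈ cfg4.lower, mN Z) - ∑ P ∈ cfg4.upper, mK P : ℤ) = 4 := by
  have h := design4.rank; rw [LN_size.2, LK_size.2] at h; exact h
theorem key_mult_pos : (∀ Z ∈ cfg4.lower, 0 < mN Z) ∧ (∀ P ∈ cfg4.upper, 0 < mK P) ∧ (∀ Z, Z ∉ cfg4.lower → mN Z = 0) ∧ (∀ P, P ∉ cfg4.upper → mK P = 0) :=
  design4.mult_pos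
/-- the key's `P`-multiplicity is `f − 4`, the design's is `f − 3`: one apex more. -/
theorem key_pad : mK (mcellOf (0, 0, 0) (0, 0, 0) (0, 0, 0) (0, 0, 0)) + 1 = mP (mcellOf (0, 0, 0) (0, 0, 0) (0, 0, 0) (0, 0, 0)) := by
  decide +kernel

/-! ### §2.7 Bridge to the door's vocabulary `SeedChecker.Design` (`SeedChecker.lean` §1, `SeedCheckerPorteous.lean` §8.5–§8.6): the rank-3 design
`D₃ = ⟨cfg, mN, mP⟩` is `Clean` with `ClassDataR 3`, the rank-4 key `D₄ = ⟨cfg4, mN, mK⟩` has `ClassData`, `μ(D₃) = μ(D₄)`, and `D₄.padApexUp 0 1 = D₃`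
literally — i.e. exactly the json hypotheses `hC0 : D.ClassData`, `hD' : D'.Clean`, `hmu : D'.mu = D.mu` of `Design.seedCheck_of_twoTermDegeneracy`
with `D = D₄`, `D' = D₃`. (The door's OTHER hypotheses — word kit, two-term realisation, the law, C5–C7 of the degeneracy scheme — are not touched.) -/

/-- the rank-3 design `(N, apex × (f−3))` as a `SeedChecker.Design` (the `D'` of the two-term door). -/
def D₃ : SeedChecker.Design := ⟨cfg, mN, mP⟩
/-- the rank-4 key `(N, apex × (f−4))` as a `SeedChecker.Design` (the `D` of the two-term door). -/
def D₄ : SeedChecker.Design := ⟨cfg4, mN, mK⟩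

theorem D₃_clean : D₃.Clean := classScreen
theorem D₃_mu : D₃.mu = ⟨128, 0⟩ := mu
theorem D₃_rank : D₃.rank = 3 := by show cfg.wch mN mP ![0, 0, 0, 0] = 3; rw [wch_one]; norm_num
theorem D₃_positive : D₃.Positive := ⟨mult_pos.1, mult_pos.2.1⟩
/-- **C0 AT RANK 3 in the door's vocabulary.** -/
theorem D₃_classDataR : D₃.ClassDataR 3 := ⟨D₃_clean, mu_ne_zero, by exact_mod_cast D₃_rank, D₃_positive⟩

theorem D₄_clean : D₄.Clean := key_classScreen_and_mu.1
theorem D₄_mu : D₄.mu = ⟨128, 0⟩ := key_classScreen_and_mu.2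
theorem D₄_rank : D₄.rank = 4 := by show cfg4.wch mN mK ![0, 0, 0, 0] = 4; rw [wch_one_eq]; exact_mod_cast key_rank
theorem D₄_positive : D₄.Positive := ⟨key_mult_pos.1, key_mult_pos.2.1⟩
/-- **C0 AT RANK 4 OF THE KEY in the door's vocabulary** (`hC0`). -/
theorem D₄_classData : D₄.ClassData := ⟨D₄_clean, key_mu_ne_zero, D₄_rank, D₄_positive⟩
/-- `μ(D') = μ(D)` (`hmu`). -/
theorem D₃_mu_eq_D₄_mu : D₃.mu = D₄.mu := by rw [D₃_mu, D₄_mu]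

/-- the door's apex cell of twist `0` is this file's apex cell. -/
theorem apexCell_zero : SeedChecker.apexCell 0 = mcellOf (0, 0, 0) (0, 0, 0) (0, 0, 0) (0, 0, 0) := by
  funext f; fin_cases f <;> rfl

/-- **THE JSON MOVE, LITERALLY**: padding the key with one apex `P`-cell of twist `0` gives the rank-3 design (`SeedCheckerPorteous` §8.6). -/
theorem D₄_padApexUp : D₄.padApexUp 0 1 = D₃ := by
  have hup : insert (SeedChecker.apexCell 0) cfg4.upper = cfg.upper := by
    ext P; rw [Finset.mem_insert, cfg4_upper, shape.2 P, apexCell_zero]; simp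
  have hmP : (fun P => (if P ∈ cfg4.upper then mK P else 0) + (if P = SeedChecker.apexCell 0 then (1 : ℤ) else 0)) = mP := by
    funext P
    by_cases hP : P = mcellOf (0, 0, 0) (0, 0, 0) (0, 0, 0) (0, 0, 0)
    · subst hP
      rw [if_pos ((cfg4_upper _).2 ((shape.2 _).2 rfl)), apexCell_zero, if_pos rfl]; exact key_pad
    · have h4 : P ∉ cfg4.upper := fun h => hP ((shape.2 P).1 ((cfg4_upper P).1 h))
      have h3 : P ∉ cfg.upper := fun h => hP ((shape.2 P).1 h)
      rw [if_neg h4, apexCell_zero, if_neg hP, zero_add]; exact (mult_pos.2.2.2 P h3).symm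
  show (⟨⟨cfg4.lower, insert (SeedChecker.apexCell 0) cfg4.upper⟩, mN,
      fun P => (if P ∈ cfg4.upper then mK P else 0) + (if P = SeedChecker.apexCell 0 then (1 : ℤ) else 0)⟩ : SeedChecker.Design) = ⟨cfg, mN, mP⟩
  rw [hup, hmP]; rfl

end DC964

namespace DCi21224

/-! ## §3 `DCi21224`: `f = 21224` letters on 178 distinct cells (9 `G₁`-orbits), `P = apex × 21221`, types `(α; β) × m` = (1,1,1,3; 0,0,0,0) × 500; (1,1,3,3; 0,0,0,0) × 300; (1,2,2,2; 0,0,0,0) × 320; (1,2,2,3; 0,0,0,2+2i) × 80; (1,3,3,3; 0,0,0,0) × 180; (2,2,2,3; 0,0,1,0) × 240; (3,3,3,3; 2+1i,2+1i,2+1i,2+1i) × 1; `μ = (-448, 1536)` -/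

/-! ### §3.1 Data -/

/-- level `N`: G₁-orbit representatives 1–4 of 9 (the orbit's minimal `key`) with their multiplicities, `(α, Re β, Im β)` per factor. -/
def repsN_1 : List (MCell × ℤ) :=
  [(mcellOf (1, 0, 0) (1, 0, 0) (1, 0, 0) (3, 0, 0), 500),
   (mcellOf (1, 0, 0) (1, 0, 0) (3, 0, 0) (3, 0, 0), 300),
   (mcellOf (1, 0, 0) (2, 0, 0) (2, 0, 0) (2, 0, 0), 320),
   (mcellOf (1, 0, 0) (2, 0, 0) (2, 0, 0) (3, -2, -2), 80)]

/-- level `N`: G₁-orbit representatives 5–8 of 9 (the orbit's minimal `key`) with their multiplicities, `(α, Re β, Im β)` per factor. -/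
def repsN_2 : List (MCell × ℤ) :=
  [(mcellOf (1, 0, 0) (3, 0, 0) (3, 0, 0) (3, 0, 0), 180),
   (mcellOf (2, -1, 0) (2, 0, 0) (2, 0, 0) (3, 0, 0), 240),
   (mcellOf (3, -2, -1) (3, -2, -1) (3, -2, -1) (3, -2, -1), 1),
   (mcellOf (3, -2, -1) (3, -2, -1) (3, -1, 2) (3, 1, -2), 1)]

/-- level `N`: G₁-orbit representatives 9–9 of 9 (the orbit's minimal `key`) with their multiplicities, `(α, Re β, Im β)` per factor. -/
def repsN_3 : List (MCell × ℤ) :=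
  [(mcellOf (3, -2, -1) (3, -2, -1) (3, 2, 1) (3, 2, 1), 1)]

/-- level `N`: all 9 representatives (9 orbits). -/
def repsN : List (MCell × ℤ) := repsN_1 ++ repsN_2 ++ repsN_3

/-- level `N`: the 178 transversal codes `i·96 + s·4 + j` of its cells in increasing `key` order, packed base 8192 (13 bits each). -/
def packedN : ℕ :=
  174962137409590064211776990534585336513680073145339189647106832538890531258587721654913620585788024064740732482724909513590776127770236383417560365193202360162915584226535031105938178140627435261417749026723975508147999319197130581455344399015226630030117307391612489813452013007318446537268830560784514076584933825842696380140790533698999433223482040139904051431997865906072688800921452389398190285089061123662815194295345690525223942567947088342548626958582162390714814709362028123519712915066939544229901747272855131680318455419531021361640178073741747907681999563775738390072660904313370747206751278991824989154900709143620612826629825805190594750644316613874507961564383867088607439484911616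

/-- level `N`: the 178 cells with multiplicities, GENERATED IN THE KERNEL from `repsN` and `packedN`. -/
def LN : List (MCell × ℤ) := genList repsN (unpack 8192 178 packedN)

/-- level `N`: its search tree. -/
def tN : CT := treeOf LN

/-- level `P`: G₁-orbit representatives 1–1 of 1 (the orbit's minimal `key`) with their multiplicities, `(α, Re β, Im β)` per factor. -/
def repsP_1 : List (MCell × ℤ) :=
  [(mcellOf (0, 0, 0) (0, 0, 0) (0, 0, 0) (0, 0, 0), 21221)]

/-- level `P`: all 1 representatives (1 orbits). -/
def repsP : List (MCell × ℤ) := repsP_1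

/-- level `P`: the 1 transversal codes `i·96 + s·4 + j` of its cells in increasing `key` order, packed base 8192 (13 bits each). -/
def packedP : ℕ :=
  0

/-- level `P`: the 1 cells with multiplicities, GENERATED IN THE KERNEL from `repsP` and `packedP`. -/
def LP : List (MCell × ℤ) := genList repsP (unpack 8192 1 packedP)

/-- level `P`: its search tree. -/
def tP : CT := treeOf LP

/-! ### §3.2 Certified levels (kernel decides) -/

/-- `N`: the tree's in-order entries ARE the generated list. [kernel `decide`, O(n)] -/
theorem tN_entries : tN.entries = LN := by decide +kernel
/-- `N`: every multiplicity is positive. [kernel `decide`] -/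
theorem LN_pos : allB LN (fun p => decide (0 < p.2)) = true := by decide +kernel
/-- `N`: every entry passes the closure check (own lookup, three adjacent transpositions, `Δ`). [kernel `decide`] -/
theorem LN_closed : allB LN (closureCheck tN) = true := by decide +kernel
/-- `N`: the cells come in strictly increasing `key` order (⇒ no duplicates). [kernel `decide`] -/
theorem LN_keys : chainB ((LN.map Prod.fst).map key) = true := by decide +kernel
/-- `N`: 178 cells, total multiplicity 21224. [kernel `decide`] -/
theorem LN_size : LN.length = 178 ∧ msum LN 0 = 21224 := by constructor <;> decide +kernel
/-- `N` is a certified level. -/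
theorem certN : LevelCert LN tN := levelCert_of LN tN tN_entries LN_pos LN_closed

/-- `P`: the tree's in-order entries ARE the generated list. [kernel `decide`, O(n)] -/
theorem tP_entries : tP.entries = LP := by decide +kernel
/-- `P`: every multiplicity is positive. [kernel `decide`] -/
theorem LP_pos : allB LP (fun p => decide (0 < p.2)) = true := by decide +kernel
/-- `P`: every entry passes the closure check (own lookup, three adjacent transpositions, `Δ`). [kernel `decide`] -/
theorem LP_closed : allB LP (closureCheck tP) = true := by decide +kernel
/-- `P`: the cells come in strictly increasing `key` order (⇒ no duplicates). [kernel `decide`] -/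
theorem LP_keys : chainB ((LP.map Prod.fst).map key) = true := by decide +kernel
/-- `P`: 1 cells, total multiplicity 21221. [kernel `decide`] -/
theorem LP_size : LP.length = 1 ∧ msum LP 0 = 21221 := by constructor <;> decide +kernel
/-- `P` is a certified level. -/
theorem certP : LevelCert LP tP := levelCert_of LP tP tP_entries LP_pos LP_closed

/-- **THE (RANK-3) DESIGN IS CERTIFIED** (`DesignCert`: both levels certified, cells in key order). -/
theorem design : DesignCert LN LP tN tP := ⟨certN, certP, isChain_of_chainB _ LN_keys, isChain_of_chainB _ LP_keys⟩

/-- the configuration (support) of the design. -/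
def cfg : MConfig := design.cfg
/-- the multiplicity function of the `N`-cells (the letters of `F`). -/
def mN : MCell → ℤ := mT tN
/-- the multiplicity function of the `P`-cells (the apex letter of `𝒪`, multiplicity `f − 3`). -/
def mP : MCell → ℤ := mT tP

/-- **THE SUPPORT IS `G₁`-CLOSED**: both levels `S₄`-closed and `Δ`-closed. -/
theorem g1Closed : PermClosed cfg.lower ∧ PermClosed cfg.upper ∧ DeltaClosed cfg.lower ∧ DeltaClosed cfg.upper := design.g1

/-- **THE MULTIPLICITIES ARE `G₁`-INVARIANT** (as functions on all cells; `0` off the support). -/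
theorem mult_invariant : (∀ σ Z, mN (MCell.perm σ Z) = mN Z) ∧ (∀ σ P, mP (MCell.perm σ P) = mP P) ∧
    (∀ Z, mN Z.delta = mN Z) ∧ (∀ P, mP P.delta = mP P) :=
  ⟨design.certN.pInv, design.certP.pInv, design.certN.dInv, design.certP.dInv⟩

/-- the multiplicities are positive on the support and zero off it. -/
theorem mult_pos : (∀ Z ∈ cfg.lower, 0 < mN Z) ∧ (∀ P ∈ cfg.upper, 0 < mP P) ∧ (∀ Z, Z ∉ cfg.lower → mN Z = 0) ∧ (∀ P, P ∉ cfg.upper → mP P = 0) :=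
  design.mult_pos

/-- cell counts and multiplicity totals of the two levels (`f = Σ m_N` letters, `Σ m_P = f − 3`). -/
theorem sizes : LN.length = 178 ∧ msum LN 0 = 21224 ∧ LP.length = 1 ∧ msum LP 0 = 21221 := ⟨LN_size.1, LN_size.2, LP_size.1, LP_size.2⟩

/-! ### §3.3 Shape of the support (kernel decides) -/

/-- every `N`-cell is an ISOTROPIC AMPLE box letter: on every factor `α > 0` and `α² > (Re β)² + (Im β)²` (the letter `α(u+v) + βe + β̄ē` of an
ample line bundle on the factor), and the `P`-level is the single APEX cell `(0,0,0)⁴` (the letter of `𝒪`). [kernel `decide`] -/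
theorem shape_all : allB LN (fun p => decide (∀ f, 0 < (p.1 f).1 ∧ (p.1 f).2.1 ^ 2 + (p.1 f).2.2 ^ 2 < (p.1 f).1 ^ 2)) = true ∧
    LP.map Prod.fst = [mcellOf (0, 0, 0) (0, 0, 0) (0, 0, 0) (0, 0, 0)] := by
  constructor <;> decide +kernel

/-- **THE LETTERS OF `F` ARE AMPLE AND ISOTROPIC, `P` IS THE APEX**: `∀ Z ∈ cfg.lower, ∀ f, 0 < α_f(Z) ∧ |β_f(Z)|² < α_f(Z)²`, and
`cfg.upper = {(0,0,0)⁴}` as a membership statement. -/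
theorem shape : (∀ Z ∈ cfg.lower, ∀ f, 0 < (Z f).1 ∧ (Z f).2.1 ^ 2 + (Z f).2.2 ^ 2 < (Z f).1 ^ 2) ∧
    ∀ P, P ∈ cfg.upper ↔ P = mcellOf (0, 0, 0) (0, 0, 0) (0, 0, 0) (0, 0, 0) :=
  ⟨fun Z hZ => by obtain ⟨p, hp, rfl⟩ := List.mem_map.1 (design.mem_lower.1 hZ); exact forall_of_allB shape_all.1 p hp,
   fun P => design.mem_upper.trans
     (by rw [shape_all.2]; simp : P ∈ LP.map Prod.fst ↔ P = mcellOf (0, 0, 0) (0, 0, 0) (0, 0, 0) (0, 0, 0))⟩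

/-! ### §3.4 The class tensor `ch(F) − (f−3)·ch(𝒪)`: two ONE-PASS evaluations over the 179 cells in exact integer arithmetic (kernel decides) -/

/-- the e-free coefficient by degree `0 … 8` (the `ℚ[h]`-part `Σ q_k h^k∕k!` of `ch(F − 𝒪^{f−3})`, coefficient on e-free words of degree `k`). -/
def q (k : ℕ) : ℤ :=
  match k with
  | 0 => 3 | 1 => 44432 | 2 => 91656 | 3 => 187248 | 4 => 379624 | 5 => 763792 | 6 => 1523336 | 7 => 3003248 | _ => 5825064

/-- **the 15 e-free representative sums** (`Σ_N m·ch − Σ_P m·ch` at `freeReps`, real parts; imaginary parts vanish by `imSum_zero`). [kernel `decide`] -/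
theorem sumA_val : sumA (LN ++ negM LP) 0 0 0 0 0 0 0 0 0 0 0 0 0 0 0 =
    [3, 44432, 91656, 187248, 379624, 91656, 187248, 379624, 763792, 379624, 763792, 1523336, 1523336, 3003248, 5825064] := by
  decide +kernel

/-- **the 7 mixed representative sums and the `eeee` sum** (re∕im pairs). [kernel `decide`] -/
theorem sumB_val : sumB (LN ++ negM LP) 0 0 0 0 0 0 0 0 0 0 0 0 0 0 0 0 =
    [0, 0, 0, 0, 0, 0, 0, 0, 0, 0, 0, 0, 0, 0, -448, 1536] := by
  decide +kernel

theorem sumA_val' : sumA (LN ++ negM LP) 0 0 0 0 0 0 0 0 0 0 0 0 0 0 0 =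
    [q 0, q 1, q 2, q 3, q 4, q 2, q 3, q 4, q 5, q 4, q 5, q 6, q 6, q 7, q 8] := by
  rw [sumA_val]; rfl

/-! ### §3.5 The theorems (tree vocabulary): C0 at virtual rank 3 -/

/-- **(A1) IN ALL DEGREES: THE WEIGHTED CLASS TENSOR `ch(F) − (f−3)·ch(𝒪)` PASSES THE CLASS SCREEN** (`Pad4TowerClassScreen.ClassScreen`, both clauses,
all `1296` words), **and μ = ⟨-448, 1536⟩**. -/
theorem classScreen_and_mu : ClassScreen (cfg.wch mN mP) ∧ cfg.wch mN mP eWord = ⟨-448, 1536⟩ :=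
  design.classScreen_of_sums q (-448) (1536) sumA_val' sumB_val

/-- **(A1).** -/
theorem classScreen : ClassScreen (cfg.wch mN mP) := classScreen_and_mu.1

/-- … equivalently `ch ∈ ℚ[h] ⊕ W` (`Pad4TowerClassScreen.inQhW_iff_classScreen`). -/
theorem inQhW : InQhW (cfg.wch mN mP) := (inQhW_iff_classScreen _).2 classScreen

/-- **μ = -448 +1536·i** (the `eeee` coefficient of the weighted class tensor, in `ℤ[i]`; the virtual `W`-coordinate of `c₄(F − 𝒪^{f−3})` is `−6μ`, pencil ∕
`SeedCheckerPorteous.virtChernFour_eq_of_virtCleanAtSeed`). -/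
theorem mu : cfg.wch mN mP eWord = ⟨-448, 1536⟩ := classScreen_and_mu.2

/-- **μ ≠ 0.** -/
theorem mu_ne_zero : cfg.wch mN mP eWord ≠ 0 := by rw [mu]; decide

/-- **RANK 3**: `Σ m_N − Σ m_P = 3` (the virtual rank of `F − 𝒪^{f−3}`). -/
theorem rank : ((∑ Z ∈ cfg.lower, mN Z) - ∑ P ∈ cfg.upper, mP P : ℤ) = 3 := by
  have h := design.rank; rw [LN_size.2, LP_size.2] at h; exact h

/-- the rank as the `1111` coefficient of the class tensor. -/
theorem wch_one : cfg.wch mN mP ![0, 0, 0, 0] = (3 : ℤ) := by rw [wch_one_eq]; exact_mod_cast rank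

/-- the e-free coefficients by degree: `wch w = q (wdeg w)` for every e-free word `w` (the `ℚ[h]` part). -/
theorem wch_eFree (w : CWord) (hw : EFree w) : cfg.wch mN mP w = ⟨q (wdeg w), 0⟩ := by
  obtain ⟨σ, -, hr⟩ := free_cover w hw
  obtain ⟨g1, g2, -, -⟩ := design.g1
  rw [← wch_uvNorm, ← cfg.wch_permW_of_permInvariant g1 g2 mN mP design.certN.pInv design.certP.pInv σ (uvNorm w), ← wdeg_uvNorm w,
    ← wdeg_permW σ (uvNorm w)]
  have hA := sumA_val'
  rw [sumA_eq] at hA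
  simp only [zero_add, List.cons.injEq, and_true] at hA
  obtain ⟨a1, a2, a3, a4, a5, a6, a7, a8, a9, a10, a11, a12, a13, a14, a15⟩ := hA
  simp only [freeReps, List.mem_cons, List.not_mem_nil, or_false] at hr
  generalize permW σ (uvNorm w) = r at hr ⊢
  rcases hr with rfl | rfl | rfl | rfl | rfl | rfl | rfl | rfl | rfl | rfl | rfl | rfl | rfl | rfl | rfl
  · exact design.wch_of_reSum _ (by decide) _ a1
  · exact design.wch_of_reSum _ (by decide) _ a2
  · exact design.wch_of_reSum _ (by decide) _ a3
  · exact design.wch_of_reSum _ (by decide) _ a4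
  · exact design.wch_of_reSum _ (by decide) _ a5
  · exact design.wch_of_reSum _ (by decide) _ a6
  · exact design.wch_of_reSum _ (by decide) _ a7
  · exact design.wch_of_reSum _ (by decide) _ a8
  · exact design.wch_of_reSum _ (by decide) _ a9
  · exact design.wch_of_reSum _ (by decide) _ a10
  · exact design.wch_of_reSum _ (by decide) _ a11
  · exact design.wch_of_reSum _ (by decide) _ a12
  · exact design.wch_of_reSum _ (by decide) _ a13
  · exact design.wch_of_reSum _ (by decide) _ a14
  · exact design.wch_of_reSum _ (by decide) _ a15

/-! ### §3.6 The rank-4 json key `D₄ = (N, apex × (f−4))`: the tree's json move `SeedChecker.Design.padApexUp 0 1` (one apex `P`-cell more) turns it into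
the rank-3 design of §3.1–§3.5 cell for cell (pencil: same `N`, `P`-multiplicity `f − 4 + 1 = f − 3`); C0 at rank 4 is what `Design.ClassData` ∕
`Design.seedCheck_of_twoTermDegeneracy` key on. Certified here in the same vocabulary. -/

/-- level `K`: the apex with multiplicity `f − 4 = 21220`. -/
def repsK : List (MCell × ℤ) := [(mcellOf (0, 0, 0) (0, 0, 0) (0, 0, 0) (0, 0, 0), 21220)]
/-- level `K`: generated list (one cell, code `0`) and tree. -/
def LK : List (MCell × ℤ) := genList repsK (unpack 8192 1 0)
def tK : CT := treeOf LK

theorem tK_entries : tK.entries = LK := by decide +kernel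
theorem LK_pos : allB LK (fun p => decide (0 < p.2)) = true := by decide +kernel
theorem LK_closed : allB LK (closureCheck tK) = true := by decide +kernel
theorem LK_keys : chainB ((LK.map Prod.fst).map key) = true := by decide +kernel
theorem LK_size : LK.length = 1 ∧ msum LK 0 = 21220 := by constructor <;> decide +kernel
theorem certK : LevelCert LK tK := levelCert_of LK tK tK_entries LK_pos LK_closed

/-- **THE RANK-4 KEY DESIGN IS CERTIFIED.** -/
theorem design4 : DesignCert LN LK tN tK := ⟨certN, certK, isChain_of_chainB _ LN_keys, isChain_of_chainB _ LK_keys⟩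
/-- its configuration and `P`-multiplicity function (the `N` side is `mN`). -/
def cfg4 : MConfig := design4.cfg
def mK : MCell → ℤ := mT tK

/-- level `K` has the single apex cell. [kernel `decide`] -/
theorem LK_cells : LK.map Prod.fst = [mcellOf (0, 0, 0) (0, 0, 0) (0, 0, 0) (0, 0, 0)] := by decide +kernel
/-- the same `P`-cell and the same `N`-cells: `cfg4.upper = cfg.upper`, `cfg4.lower = cfg.lower` as membership statements. -/
theorem cfg4_upper (P : MCell) : P ∈ cfg4.upper ↔ P ∈ cfg.upper :=
  (design4.mem_upper.trans (by rw [LK_cells, shape_all.2] : P ∈ LK.map Prod.fst ↔ P ∈ LP.map Prod.fst)).trans design.mem_upper.symm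
theorem cfg4_lower (Z : MCell) : Z ∈ cfg4.lower ↔ Z ∈ cfg.lower := Iff.rfl

theorem sumA4_val : sumA (LN ++ negM LK) 0 0 0 0 0 0 0 0 0 0 0 0 0 0 0 =
    [4, 44432, 91656, 187248, 379624, 91656, 187248, 379624, 763792, 379624, 763792, 1523336, 1523336, 3003248, 5825064] := by
  decide +kernel
theorem sumB4_val : sumB (LN ++ negM LK) 0 0 0 0 0 0 0 0 0 0 0 0 0 0 0 0 =
    [0, 0, 0, 0, 0, 0, 0, 0, 0, 0, 0, 0, 0, 0, -448, 1536] := by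
  decide +kernel
/-- the key's e-free coefficients: `q` with `q 0 = 4`. -/
def q4 (k : ℕ) : ℤ := match k with | 0 => 4 | k => q k
theorem sumA4_val' : sumA (LN ++ negM LK) 0 0 0 0 0 0 0 0 0 0 0 0 0 0 0 =
    [q4 0, q4 1, q4 2, q4 3, q4 4, q4 2, q4 3, q4 4, q4 5, q4 4, q4 5, q4 6, q4 6, q4 7, q4 8] := by
  rw [sumA4_val]; rfl

/-- **C0 AT RANK 4 OF THE KEY**: (A1) in all degrees, the same `μ = ⟨-448, 1536⟩ ≠ 0`, rank `4`, positive multiplicities. -/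
theorem key_classScreen_and_mu : ClassScreen (cfg4.wch mN mK) ∧ cfg4.wch mN mK eWord = ⟨-448, 1536⟩ :=
  design4.classScreen_of_sums q4 (-448) (1536) sumA4_val' sumB4_val
theorem key_mu_ne_zero : cfg4.wch mN mK eWord ≠ 0 := by rw [key_classScreen_and_mu.2]; decide
theorem key_rank : ((∑ Z ∈ cfg4.lower, mN Z) - ∑ P ∈ cfg4.upper, mK P : ℤ) = 4 := by
  have h := design4.rank; rw [LN_size.2, LK_size.2] at h; exact h
theorem key_mult_pos : (∀ Z ∈ cfg4.lower, 0 < mN Z) ∧ (∀ P ∈ cfg4.upper, 0 < mK P) ∧ (∀ Z, Z ∉ cfg4.lower → mN Z = 0) ∧ (∀ P, P ∉ cfg4.upper → mK P = 0) :=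
  design4.mult_pos
/-- the key's `P`-multiplicity is `f − 4`, the design's is `f − 3`: one apex more. -/
theorem key_pad : mK (mcellOf (0, 0, 0) (0, 0, 0) (0, 0, 0) (0, 0, 0)) + 1 = mP (mcellOf (0, 0, 0) (0, 0, 0) (0, 0, 0) (0, 0, 0)) := by
  decide +kernel

/-! ### §3.7 Bridge to the door's vocabulary `SeedChecker.Design` (`SeedChecker.lean` §1, `SeedCheckerPorteous.lean` §8.5–§8.6): the rank-3 design
`D₃ = ⟨cfg, mN, mP⟩` is `Clean` with `ClassDataR 3`, the rank-4 key `D₄ = ⟨cfg4, mN, mK⟩` has `ClassData`, `μ(D₃) = μ(D₄)`, and `D₄.padApexUp 0 1 = D₃`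
literally — i.e. exactly the json hypotheses `hC0 : D.ClassData`, `hD' : D'.Clean`, `hmu : D'.mu = D.mu` of `Design.seedCheck_of_twoTermDegeneracy`
with `D = D₄`, `D' = D₃`. (The door's OTHER hypotheses — word kit, two-term realisation, the law, C5–C7 of the degeneracy scheme — are not touched.) -/

/-- the rank-3 design `(N, apex × (f−3))` as a `SeedChecker.Design` (the `D'` of the two-term door). -/
def D₃ : SeedChecker.Design := ⟨cfg, mN, mP⟩
/-- the rank-4 key `(N, apex × (f−4))` as a `SeedChecker.Design` (the `D` of the two-term door). -/
def D₄ : SeedChecker.Design := ⟨cfg4, mN, mK⟩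

theorem D₃_clean : D₃.Clean := classScreen
theorem D₃_mu : D₃.mu = ⟨-448, 1536⟩ := mu
theorem D₃_rank : D₃.rank = 3 := by show cfg.wch mN mP ![0, 0, 0, 0] = 3; rw [wch_one]; norm_num
theorem D₃_positive : D₃.Positive := ⟨mult_pos.1, mult_pos.2.1⟩
/-- **C0 AT RANK 3 in the door's vocabulary.** -/
theorem D₃_classDataR : D₃.ClassDataR 3 := ⟨D₃_clean, mu_ne_zero, by exact_mod_cast D₃_rank, D₃_positive⟩

theorem D₄_clean : D₄.Clean := key_classScreen_and_mu.1
theorem D₄_mu : D₄.mu = ⟨-448, 1536⟩ := key_classScreen_and_mu.2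
theorem D₄_rank : D₄.rank = 4 := by show cfg4.wch mN mK ![0, 0, 0, 0] = 4; rw [wch_one_eq]; exact_mod_cast key_rank
theorem D₄_positive : D₄.Positive := ⟨key_mult_pos.1, key_mult_pos.2.1⟩
/-- **C0 AT RANK 4 OF THE KEY in the door's vocabulary** (`hC0`). -/
theorem D₄_classData : D₄.ClassData := ⟨D₄_clean, key_mu_ne_zero, D₄_rank, D₄_positive⟩
/-- `μ(D') = μ(D)` (`hmu`). -/
theorem D₃_mu_eq_D₄_mu : D₃.mu = D₄.mu := by rw [D₃_mu, D₄_mu]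

/-- the door's apex cell of twist `0` is this file's apex cell. -/
theorem apexCell_zero : SeedChecker.apexCell 0 = mcellOf (0, 0, 0) (0, 0, 0) (0, 0, 0) (0, 0, 0) := by
  funext f; fin_cases f <;> rfl

/-- **THE JSON MOVE, LITERALLY**: padding the key with one apex `P`-cell of twist `0` gives the rank-3 design (`SeedCheckerPorteous` §8.6). -/
theorem D₄_padApexUp : D₄.padApexUp 0 1 = D₃ := by
  have hup : insert (SeedChecker.apexCell 0) cfg4.upper = cfg.upper := by
    ext P; rw [Finset.mem_insert, cfg4_upper, shape.2 P, apexCell_zero]; simp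
  have hmP : (fun P => (if P ∈ cfg4.upper then mK P else 0) + (if P = SeedChecker.apexCell 0 then (1 : ℤ) else 0)) = mP := by
    funext P
    by_cases hP : P = mcellOf (0, 0, 0) (0, 0, 0) (0, 0, 0) (0, 0, 0)
    · subst hP
      rw [if_pos ((cfg4_upper _).2 ((shape.2 _).2 rfl)), apexCell_zero, if_pos rfl]; exact key_pad
    · have h4 : P ∉ cfg4.upper := fun h => hP ((shape.2 P).1 ((cfg4_upper P).1 h))
      have h3 : P ∉ cfg.upper := fun h => hP ((shape.2 P).1 h)
      rw [if_neg h4, apexCell_zero, if_neg hP, zero_add]; exact (mult_pos.2.2.2 P h3).symm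
  show (⟨⟨cfg4.lower, insert (SeedChecker.apexCell 0) cfg4.upper⟩, mN,
      fun P => (if P ∈ cfg4.upper then mK P else 0) + (if P = SeedChecker.apexCell 0 then (1 : ℤ) else 0)⟩ : SeedChecker.Design) = ⟨cfg, mN, mP⟩
  rw [hup, hmP]; rfl

end DCi21224

end Summit.HodgeConjecture.HodgeConjecture.Cruxes.BlochSeedDiscOne.SplitCarrierClassCert
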